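import Literature.MathematicalPhysics.QuantumFieldTheory.Dimock2011to13.HoleSummability
import Literature.MathematicalPhysics.QuantumFieldTheory.Dimock2011to13.Reblocking

/-!
# Dimock, *The renormalization group according to Balaban* III, §3.5 "convergence" FROM (randall) ON: the history sum
PROVED on the torus, LEMMA 15 (sushi) derived from the shapes (randall) ∧ LEMMA 14 (ugh2), and the substitution
(under) ∧ (sushi) ⇒ (under2) — so that §3 is kernel-checked from (stingray) ∧ (under) ∧ (randall) ∧ Lemma 14 to Corollary 1

**Citation header (reproduction of PUBLISHED work; template of the Balaban lattice Yang–Mills cell).**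
J. Dimock, *The renormalization group according to Balaban. III. Convergence*, Ann. Henri Poincaré **15** (2014)
2133–2175 (= arXiv:1304.0705v1) [Dimock2013BalabanIII]: §3.2 "first bounds" eq. (under) (TeX L1583–1601), §3.4 "final
integrals" eq. (randall) (TeX L2149–2155), §3.5 "convergence" (TeX L2160–2342: eq. (ugh1) L2164–2170, Lemma 14 = (ugh2)
L2173–2177 with proof L2180–2249, Lemma 15 = (sushi) L2254–2258 with proof L2262–2335 and the Remark L2338–2342), §3.6 eq.
(under2) (TeX L2349–2358); §3.2 for the histories {P_j, Q_j, R_j} (TeX L1651–1660) and §2.4 for R_{𝖭+1} (TeX L781–795).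
Lemma numbers are those of the global counter `\newtheorem{lem}{Lemma}` of the arXiv source (Lemma 14 = (ugh2), Lemma
15 = (sushi), Lemma 16 = the three-sorted bound, Lemma 17 = (swat); cf. this lineage's `…ThreeSortedResummation`).  J.
Dimock, *… II. Large fields*, J. Math. Phys. **54** (2013) 092301 (= arXiv:1212.5562v2) [Dimock2013BalabanII], §3.1 for
`r_k = (−log λ_k)^r = ((N−k) log L − log λ)^r` (TeX L1653–1655) and `p_{0,k} ≤ p_k` (TeX L3638–3640).  TeX line numbers
refer to the arXiv sources held by the cell (`inputs/files/dimock/src/1304.0705/1304.0705.tex`, `…/1212.5562/*.tex`);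
every quotation below was read there this session.  Dimock's papers are published and refereed and are the cell's
TEMPLATE, not manuscripts under audit; no quantity of the Bałaban series is touched.

**Why this module.**  With `…Phi43PolymerRepresentation` (p182971), `…ThreeSortedResummation` (p184096) and
`…HoleSummability` (p184078) this lineage made [Dimock2013BalabanIII] §3.6 kernel over the cell's torus polymer model
from the shapes (stingray) ∧ (under2) on, and recorded as NOT kernel *"§3.1–3.5 ((stingray), (under), Lemma 14 (ugh2),
Lemma 15 (sushi): the history sum giving 𝒦′(Θ) ≤ Π_γ λ^{n₀} e^{−κ′|Θ_γ|_M})"* (docstring of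
`ThreeSorted.stability_of_under2`; TEMPLATE.md v8.17 §4.3).  Dimock himself marks the cut between analysis and
combinatorics at eq. (randall), TeX L2155: *"At this point all the fields are gone."*, and opens §3.5 with (TeX L2161)
*"We estimate the last sum. This analysis is more or less model independent, we follow [Bal82b]."* — the B2 §3.C
combinatorics that B10 §D and B14 p. 264 invoke by reference (cell target T-G2; Bałaban side kernel in pv04's `B2Sect3C`).
This module kernel-checks EVERYTHING AFTER THAT CUT on the template side, except the one geometric covering lemma
(Lemma 14), which stays a quoted, published, proved leaf.

**What is reproduced here (kernel-checked; Mathlib + the imported cell modules only).**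
* Part 1 — the free resummation over subsets `Σ_{P⊆F} e^{−a|P|} = (1 + e^{−a})^{|F|} ≤ e^{|F|e^{−a}}`, in layers.
* Part 2 — ON THE TORUS (every `d`): the FINE CUBES at depth `m` inside a union `Θ` of `M`-cubes of the final torus =
  the fibres over `Θ` of the block map `tcoarse (L^m) n` of unit pv22's `…TreeLengthTorusTransfer` (*"unions of
  L^{−(𝖭−j)}M cubes □ contained in Θ"*, TeX L2310), their count `≤ (L^m)^d |Θ|_M` (this lineage's
  `Reblocking.card_filter_tcoarse_mem_le`; print: *"|Θ|_{L^{(𝖭−j)}M} = L^{3(𝖭−j)}|Θ|_M"*, TeX L2330); the REGION HISTORIES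
  `{P_j, Q_j, R_j}_{j=0}^{𝖭+1}` with all constraints dropped except the cube sizes (`Hist`, `freeHist`); the free history
  sum EXACTLY (`sum_freeHist_prod_exp_eq`, by `Finset.prod_univ_sum` twice) and BOUNDED (`sum_freeHist_prod_exp_le`);
  and, at `d = 3`, **(sally) ⇒ *"≤ |Θ|_M"* PROVED** (`sally`: for rates `a_j ≥ n₀(−log λ_j)`, `n₀ ≥ 4`, `L ≥ 2`, the free
  history sum is `≤ exp(9 λ^{n₀} |Θ|_M)`, via the geometric series over the depths).
* Part 3 — **LEMMA 15 (sushi) DERIVED** from the hypothesis shapes (randall) (`RandallBound`: the volumes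
  `|(Λ_j^c)^{(j)}|` abstracted as a function `v` of the history) and Lemma 14 (ugh2) (`Ugh2Bound`, in the two forms the
  printed proof uses), following the printed proof step by step with every *"sufficiently large"* turned into a named
  inequality (`LargeLog`): (S1) `sum_vol_le` = TeX L2262–2272, (S2) `first_term_le` = TeX L2287, (S3) `mass_le_third` =
  TeX L2287–2299, (S4) = `sally`; conclusion in PER-CUBE PRODUCT FORM `𝒦′(Θ) ≤ (λ^{n₀} e^{−(κ−1)})^{|Θ|_M}`
  (`sushi_of_randall`), whence the printed form for `|Θ|_M ≥ 1` (`printed_of_perCube`) and the component form of the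
  Remark TeX L2338–2342 for any partition of `Θ` (`prod_form_of_perCube`).
* Part 4 — **(under) as a hypothesis shape** (`UnderBound`, TeX L1583–1601, with *"disjoint Θ_γ"* as printed) and the
  SUBSTITUTION **(under) ∧ (sushi) ⇒ (under2)** = this lineage's `ThreeSorted.Under2Bound` (`under2_of_under`; the
  Θ-factor by *"|Θ_γ|_M ≥ d_M(Θ_γ)"*, TeX L2339, = pv22's `torusTreeLen_le_card_sub_one`).
* Part 5 — the END CHAIN: `stability_of_under` ((stingray) ∧ (under) ∧ per-cube (sushi) ⇒ Corollary 1, through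
  `HoleSummability.stability_of_under2`) and `stability_of_randall` ((stingray) ∧ (under) ∧ [(randall) ∧ (ugh2) for
  every Θ] ∧ `LargeLog` ⇒ Corollary 1): on the template side [Dimock2013BalabanIII] §3 is thereby kernel from the outputs
  of the analytic §§3.1–3.4 ((stingray), (under), (randall)) and the covering Lemma 14 on.

**Readings / divergences (declared).**  (i) LEMMA 14 (ugh2) is NOT re-proved: it is a covering statement about Dimock's
own regions Λ_k^c generated by the recursion (understood) (TeX L1654–1660: enlargements (·)^{5*}, (·)^{c,5*}, scalings),
which the cell's torus model does not carry; it enters as the shape `Ugh2Bound` for the abstract volumes `v` of the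
(randall) shape, in the two forms the print uses (per level, TeX L2263; at the top with `Λ^c_{𝖭+1} = Θ` and
`|Θ^{(𝖭)}| = M³|Θ|_M`, TeX L2292–2294).  (ii) ALL `3(𝖭+2)` REGION SLOTS ARE FREE: the print's convention *"P₀, R₀,
Q_{𝖭+1}, P_{𝖭+1} = ∅"* (TeX L1652) is not imposed — allowing the four empty slots ENLARGES the free sum (weaker
hypothesis `H ⊆ freeHist`), and costs the explicit constant in `9 λ^{n₀} ≤ 1` (field `LargeLog.nine`; print, TeX
L2330–2334: *"3λ^{n₀}|Θ|_M Σ_{j=0}^{𝖭+1} L^{−(N−j)(n₀−3)} ≤ |Θ|_M"*, tacitly for λ small).  (iii) LEVEL 𝖭+1 HAS DEPTH 0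
AND THE PARAMETERS OF LEVEL 𝖭: `ell (𝖭+1) = ell 𝖭 = −log λ` (`dep`, `ell`).  Source: the only region of level 𝖭+1 is
R_{𝖭+1}, *"still M cubes"* (TeX L1652), weighed by `ζ^w_𝖭` (TeX L1686: *"Π_{j=−1}^{𝖭} ζ^q_j(P_{j+1}) ζ^0_{j+1}(Q_{j+1})
ζ^w_j(R_{j+1})"*) whose threshold is `p_{0,𝖭}` (TeX L792: *"χ^w_{𝖭+1}(Λ_{𝖭+1}) enforces |W_𝖭| ≤ p_{0,𝖭} everywhere in
Λ_{𝖭+1}"*).  This is also the reading under which the printed step TeX L2290–2291 *"exp(Σ_{j=0}^{𝖭+1} −⅓c₂p²_{0,j}|𝒞_j|) ≤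
exp(−⅓c₂p²_{0,𝖭}Σ_{j=0}^{𝖭+1}|𝒞_j|)"* is valid (it needs `p_{0,j} ≥ p_{0,𝖭}` for ALL `j ≤ 𝖭+1`; with the formula
`λ_j = L^{−(𝖭−j)}λ` extended literally to `j = 𝖭+1` one would have `p_{0,𝖭+1} < p_{0,𝖭}`) — a Dimock-internal remark for
the cell's T-G22 list, records only; in the term `C(−log λ_{𝖭+1})|(Λ^c_{𝖭+1})^{(𝖭+1)}|` the reading enlarges the
printed majorant (weaker hypothesis).  (iv) THE SPLIT INTO THIRDS is applied to the printed SUM of the three cube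
counts of (randall) directly (|𝒞_j| ≤ |P_j|+|Q_j|+|R_j|, the print's (ugh1) "=" being "≤" for overlapping regions),
so the slot rate is `⅓c₂p²_{0,j}` where the print, having first replaced the sum by `|𝒞_j|`, uses `(1/9)c₂p²_{0,j}` (TeX
L2311–2315) — immaterial (field `LargeLog.slot`: `e^{−⅓c₂p²_{0,j}} ≤ λ_j^{n₀}`).  (v) CONSTANTS OF (under): the two
displayed constants `𝒪(1)` (for X_α) and `𝒪(1)B₀` (for Y_σ) of TeX L1586 are majorised by ONE constant `C`, as the
print itself does in (under2) (TeX L2355–2356, `𝒪(1)` for both); `B₀` *"depending on L, M"* (TeX L357) is thus inside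
`C`.  (vi) EXPLICIT LARGENESS: the structure `LargeLog` lists the parameter conditions the printed proof uses in words
(*"We can assume 3r+2 < 2p₀. Then for −log λ … sufficiently large"* L2287; *"assume ½c₂′(−log λ)^{2p₀−3r} ≥ κ"* L2299;
*"(1 + e^{−(1/9)c₂p²_{0,j}}) ≤ (1 + λ_j^{n₀})"* L2316; *"… ≤ |Θ|_M"* L2333; *"N − i ≤ (N−i) log L − log λ"* L2272),
plus the one it uses tacitly for the factor `λ^{n₀}` at L2294–2299 (`power`); with them the conclusion comes out in the
per-cube form `(λ^{n₀}e^{−(κ−1)})^{|Θ|_M}` (one `λ^{n₀}` PER CUBE rather than per component — what (S3) gives), which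
implies both printed forms; the rate is `κ − 1` as in print (*"Since κ − 1 > κ′ this yields the desired bound"*, L2335) and
the consumer `under2_of_under` accepts any rate `κ₁ ≥ κ′ ≥ 0`.  (vii) INDEX SETS: `RandallBound`/`Ugh2Bound` quantify
over an arbitrary finite set `H` of free histories (print: those with `Λ^c_{𝖭+1} = Θ`) — the printed (randall) and
(ugh2), restricted to the actual histories and their actual volumes, are an instance; `UnderBound` uses the relaxed index
set of `ThreeSorted.Under2Bound` (reading (iii) there) except that `{Θ_γ}` is kept pairwise disjoint as printed (TeX
L1469: *"over disjoint Θ_γ"*), which the substitution needs (`#𝒯 ≤ |Θ|_M`).  (viii) The cell's torus-model conventions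
D-pv22.1 / D-pv22g2.1 apply as in the sibling modules; `r` is a natural number (*"some postive [sic] integer r"*, II TeX
L1655), `p₀` real, `p²_{0,j} = (−log λ_j)^{2p₀}` a real power.

**What is NOT claimed.**  (randall), (ugh2), (under), (stingray) are hypothesis shapes, not asserted; Lemma 14's
covering argument, the small-factor analysis §3.3, the Gaussian integrals §3.4, the rearrangement §3.1 and the first
bounds §3.2 are NOT typed (they involve the fields); Theorem 1 (the flow) is not touched; the factorisation of 𝒦′ over
the components of Θ (first sentence of the Remark, TeX L2338) is not needed and not proved — the per-cube form gives
the product form directly.  Value = kernel closure of the template's history-sum step (the model-independent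
combinatorics Dimock attributes to [Bal82b] = B2 §3) over the cell's own torus model, NOT summit progress (YM₄ on T⁴ /
infinite volume / mass gap are elsewhere and out of scope).

Cell records: TEMPLATE.md §4.3 (row D3 §3.5), §15.2 (kernel status), §20 (T-G2/T-G9/T-G22 words); GAPS.md C-tmpl13-4,
C-tmpl15-1, C-tmpl15-2, C-tmpl15-3 (the siblings' certificates) and this module's row C-tmpl16-1; unit
`b2b-balaban-template` gen 16, journal claim D3-SUSHI-HISTORYSUM-KERNEL.  NEW leaf; imports `…Dimock2011to13.HoleSummability`
(this lineage, p184078; through it `…ThreeSortedResummation` p184096, `…Phi43PolymerRepresentation` p182971, pv22's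
`TreeLengthTorus*`) and `…Dimock2011to13.Reblocking` (this lineage, p183285; through it pv22's `…TreeLengthTorusTransfer`
with the block map `tcoarse`); sub-namespace `…Dimock2011to13.HistorySum`; modifies nothing.  v1.1 (same
seat): docstring-only fold of XREAD C-ref6-116 (referee-6 g29: boundary clean, 0 violations, DOCFIX owed none;
advisories A1 `hRU` over every Θ — clause added to `sushiPerCube_of_randall`; A2 the tacit `log L ≥ 1` behind TeX L2272
— noted at `LargeLog.logL`; A3 locator L791 → L792); declarations and proofs byte-identical to v1.
-/

noncomputable section

open Real Finset
open Literature.MathematicalPhysics.QuantumFieldTheory.Balaban1983to89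
open Literature.MathematicalPhysics.QuantumFieldTheory.Balaban1983to89.TreeLengthTorus
open Literature.MathematicalPhysics.QuantumFieldTheory.Balaban1983to89.TreeLengthTorusTransfer (tcoarse)
open Literature.MathematicalPhysics.QuantumFieldTheory.Balaban1983to89.B12TreeDecay (kappa₀ K₀ K₀_pos)

namespace Literature.MathematicalPhysics.QuantumFieldTheory.Dimock2011to13.HistorySum

open Literature.MathematicalPhysics.QuantumFieldTheory.Dimock2011to13.ThreeSorted
open Literature.MathematicalPhysics.QuantumFieldTheory.Dimock2011to13.HoleSummability (kappa₁ K₁ K₁_pos)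

/-! ## Part 1. The free resummation over subsets, once and in layers -/

/-- `Σ_{P ⊆ F} e^{−a|P|} = (1 + e^{−a})^{|F|}`. [folklore] -/
theorem sum_powerset_exp_neg_mul_card {α : Type*} [DecidableEq α] (F : Finset α) (a : ℝ) :
    ∑ P ∈ F.powerset, exp (-(a * P.card)) = (1 + exp (-a)) ^ F.card := by
  have h : ∀ P ∈ F.powerset, exp (-(a * P.card)) = ∏ _x ∈ P, exp (-a) := by
    intro P _
    rw [prod_const, ← Real.exp_nat_mul]
    congr 1
    ring
  rw [sum_congr rfl h, ← Finset.prod_one_add, prod_const]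

/-- `(1 + x)^k ≤ e^{kx}` for `x ≥ 0`. [folklore] -/
theorem one_add_pow_le_exp_mul {x : ℝ} (hx : 0 ≤ x) (k : ℕ) : (1 + x) ^ k ≤ exp (k * x) := by
  rw [Real.exp_nat_mul]
  exact pow_le_pow_left₀ (by linarith) (by linarith [Real.add_one_le_exp x]) k


/-! ## Part 2. The torus: fine cubes at depth `m`, region histories, the free history sum, (sally) -/

section Torus

variable {d : ℕ} (L n : ℕ) [NeZero L] [NeZero n]

/-- THE FINE CUBES AT DEPTH `m` INSIDE `Θ`: the `L^{−m}M`-cubes contained in the union `Θ` of `M`-cubes of the final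
torus (`n` `M`-cubes per direction) — on the cell's periodic carrier, the cubes of the torus with `L^m · n` cubes per
direction whose `L^m`-block (pv22's block map `tcoarse (L^m) n`, `…TreeLengthTorusTransfer`) lies in `Θ`.
[Dimock2013BalabanIII] TeX L2310: *"Now drop all conditions on P_j, Q_j, R_j except that they are unions of
L^{−(𝖭−j)}M cubes □ contained in Θ."* [cite: Dimock2013BalabanIII, §3.5 proof of Lemma 15 (arXiv:1304.0705v1 TeX L2310)] -/
def fine (m : ℕ) (Θ : Finset (TPt d n)) : Finset (TPt d (L ^ m * n)) :=
  univ.filter fun a => tcoarse (L ^ m) n a ∈ Θ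

/-- *"|Θ|_{L^{(𝖭−j)}M} = L^{3(𝖭−j)} |Θ|_M"* (TeX L2330) as an upper bound in every dimension: the number of fine cubes at
depth `m` inside `Θ` is at most `(L^m)^d |Θ|` (this lineage's `Reblocking.card_filter_tcoarse_mem_le`, from pv11's
`coarse_eq_iff`). [cite: Dimock2013BalabanIII, §3.5 proof of Lemma 15 (arXiv:1304.0705v1 TeX L2330)] -/
theorem card_fine_le (m : ℕ) (Θ : Finset (TPt d n)) : (fine L n m Θ).card ≤ (L ^ m) ^ d * Θ.card :=
  Reblocking.card_filter_tcoarse_mem_le Θ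

/-- The DEPTH of level `j ∈ {0, …, 𝖭+1}` below the final scale: the regions of level `j ≤ 𝖭` are unions of
`L^{−(𝖭−j)}M` cubes ([Dimock2013BalabanIII] TeX L1652: *"Each of these is a union of L^{−(𝖭−j)}M cubes in 𝕋^{−𝖭}_𝖬
(except R_{𝖭+1} is still M cubes)"*), so `dep j = 𝖭 − j` for `j ≤ 𝖭` and `dep (𝖭+1) = 0` (truncated subtraction).
[cite: Dimock2013BalabanIII, §3.2 (arXiv:1304.0705v1 TeX L1651–1653)] -/
def dep (N : ℕ) (j : Fin (N + 2)) : ℕ := N - j.val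

/-- A REGION HISTORY `{P_j, Q_j, R_j}_{j=0}^{𝖭+1}` with all constraints dropped except the cube sizes: for each level `j`
and each of the three letters (`0 ↦ P_j`, `1 ↦ Q_j`, `2 ↦ R_j`) a finite set of fine cubes at depth `dep j`
([Dimock2013BalabanIII] TeX L1651–1653: *"The sum over Π⁺ = (Λ₀, Ω₁, Λ₁, …, Ω_{𝖭+1}, Λ_{𝖭+1}) can now can be written as
a sum over regions {P_j, Q_j, R_j}_{j=0}^{𝖭+1} with the convention that P₀, R₀, Q_{𝖭+1}, P_{𝖭+1} = ∅"*; the four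
empty slots are NOT removed here — allowing them enlarges the free sum, reading (ii) of the header).
[cite: Dimock2013BalabanIII, §3.2 (arXiv:1304.0705v1 TeX L1651–1653)] -/
abbrev Hist (d L n N : ℕ) [NeZero L] [NeZero n] : Type :=
  (j : Fin (N + 2)) → Fin 3 → Finset (TPt d (L ^ dep N j * n))

/-- THE FREE HISTORIES OVER `Θ`: every region of every level is a set of fine cubes (of its depth) inside `Θ` — the
index set after *"drop all conditions on P_j, Q_j, R_j except that they are unions of L^{−(𝖭−j)}M cubes □ contained in
Θ"* (TeX L2310). [cite: Dimock2013BalabanIII, §3.5 proof of Lemma 15 (arXiv:1304.0705v1 TeX L2310)] -/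
def freeHist (N : ℕ) (Θ : Finset (TPt d n)) : Finset (Hist d L n N) :=
  Fintype.piFinset fun j => Fintype.piFinset fun _ : Fin 3 => (fine L n (dep N j) Θ).powerset

variable {L n}

/-- Membership in `freeHist`: every region lies in the fine cubes of its depth inside `Θ`. [folklore] -/
theorem mem_freeHist {N : ℕ} {Θ : Finset (TPt d n)} {h : Hist d L n N} :
    h ∈ freeHist L n N Θ ↔ ∀ j X, h j X ⊆ fine L n (dep N j) Θ := by
  simp [freeHist, Fintype.mem_piFinset]

/-- THE FREE HISTORY SUM, EXACTLY: with one rate `a_j` per level,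
`Σ_{free histories} Π_j Π_{X ∈ {P,Q,R}} e^{−a_j |X_j|} = Π_j ((1 + e^{−a_j})^{#fine_j(Θ)})³` — the finite form of
[Dimock2013BalabanIII] TeX L2311–2321: *"Each sum is estimated separately. For P_j we … estimate Σ_{P_j ⊂ Θ} exp(−(1/9)c₂
p²_{0,j}|P_j|_{L^{(N−j)}M}) = Π_{□⊂Θ}(1 + e^{−(1/9)c₂p²_{0,j}}) … The estimates on Q_j, R_j are the same."*
[cite: Dimock2013BalabanIII, §3.5 proof of Lemma 15 (arXiv:1304.0705v1 TeX L2311–2321)] -/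
theorem sum_freeHist_prod_exp_eq {N : ℕ} (Θ : Finset (TPt d n)) (a : Fin (N + 2) → ℝ) :
    ∑ h ∈ freeHist L n N Θ, ∏ j, ∏ X, exp (-(a j * (h j X).card))
      = ∏ j : Fin (N + 2), ((1 + exp (-(a j))) ^ (fine L n (dep N j) Θ).card) ^ 3 := by
  have outer : (∑ h ∈ freeHist L n N Θ, ∏ j, ∏ X, exp (-(a j * ((h j X).card : ℝ)))) =
      ∏ j, ∑ g ∈ Fintype.piFinset (fun _ : Fin 3 => (fine L n (dep N j) Θ).powerset),
        ∏ X, exp (-(a j * ((g X).card : ℝ))) :=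
    (Finset.prod_univ_sum (fun j => Fintype.piFinset fun _ : Fin 3 => (fine L n (dep N j) Θ).powerset)
      (fun j g => ∏ X, exp (-(a j * ((g X).card : ℝ))))).symm
  have inner : ∀ j : Fin (N + 2),
      (∑ g ∈ Fintype.piFinset (fun _ : Fin 3 => (fine L n (dep N j) Θ).powerset),
        ∏ X, exp (-(a j * ((g X).card : ℝ)))) =
      ∏ _X : Fin 3, ∑ P ∈ (fine L n (dep N j) Θ).powerset, exp (-(a j * (P.card : ℝ))) :=
    fun j => (Finset.prod_univ_sum (fun _ : Fin 3 => (fine L n (dep N j) Θ).powerset)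
      (fun _ P => exp (-(a j * (P.card : ℝ))))).symm
  rw [outer]
  refine prod_congr rfl fun j _ => ?_
  rw [inner j, prod_const, card_univ, Fintype.card_fin, sum_powerset_exp_neg_mul_card]

/-- THE FREE HISTORY SUM, BOUNDED: `Σ_{free histories} Π_j Π_X e^{−a_j|X_j|} ≤ exp(3 Σ_j #fine_j(Θ) · e^{−a_j})` —
[Dimock2013BalabanIII] TeX L2315–2326: *"≤ Π_{□⊂Θ} e^{λ_j^{n₀}} ≤ exp(λ_j^{n₀}|Θ|_{L^{(N−j)}M}) … Our bound becomes |𝒦′(Θ)|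
≤ λ^{n₀} e^{−κ|Θ|_M} exp(Σ_{j=0}^{𝖭+1} 3 λ_j^{n₀} |Θ|_{L^{(𝖭−j)}M})"* with `e^{−a_j}` in place of `λ_j^{n₀}`.
[cite: Dimock2013BalabanIII, §3.5 proof of Lemma 15, eq. (sally) (arXiv:1304.0705v1 TeX L2315–2326)] -/
theorem sum_freeHist_prod_exp_le {N : ℕ} (Θ : Finset (TPt d n)) (a : Fin (N + 2) → ℝ) :
    ∑ h ∈ freeHist L n N Θ, ∏ j, ∏ X, exp (-(a j * (h j X).card))
      ≤ exp (3 * ∑ j : Fin (N + 2), (fine L n (dep N j) Θ).card * exp (-(a j))) := by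
  rw [sum_freeHist_prod_exp_eq, mul_sum, Real.exp_sum]
  refine prod_le_prod (fun j _ => by positivity) fun j _ => ?_
  rw [← pow_mul, show 3 * (((fine L n (dep N j) Θ).card : ℝ) * exp (-a j))
      = (((fine L n (dep N j) Θ).card * 3 : ℕ) : ℝ) * exp (-a j) by push_cast; ring]
  exact one_add_pow_le_exp_mul (exp_pos _).le _

/-- *"−log λ_j"* of level `j`: `λ_j = L^{−(𝖭−j)}λ`, so `−log λ_j = (𝖭−j) log L − log λ` ([Dimock2013BalabanII] TeX L1653:
*"r_k = r(λ_k) = (−log λ_k)^r = ((N−k) log L − log λ)^r"*); at level `𝖭+1` the depth is `0` and the small-field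
parameter of `R_{𝖭+1}` is `p_{0,𝖭}` ([Dimock2013BalabanIII] TeX L792: *"χ^w_{𝖭+1}(Λ_{𝖭+1}) enforces |W_𝖭| ≤ p_{0,𝖭}"*),
so `ell (𝖭+1) = ell 𝖭 = −log λ` (reading (iii) of the header). [cite: Dimock2013BalabanII, §3.1 (arXiv:1212.5562v2 TeX L1653)] -/
def ell (L : ℕ) (lam : ℝ) (N : ℕ) (j : Fin (N + 2)) : ℝ := (dep N j : ℝ) * Real.log L - Real.log lam

/-- `−log λ ≤ −log λ_j` (*"−log λ_j ≤ −log λ_i"* for `j ≥ i`, TeX L2272, at the top level). [folklore] -/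
theorem neg_log_le_ell {L : ℕ} (hL : 1 ≤ L) {lam : ℝ} (N : ℕ) (j : Fin (N + 2)) :
    -Real.log lam ≤ ell L lam N j := by
  have : 0 ≤ (dep N j : ℝ) * Real.log L :=
    mul_nonneg (Nat.cast_nonneg _) (Real.log_nonneg (by exact_mod_cast hL))
  unfold ell; linarith

/-- `ell` is antitone in the level: *"−log λ_j ≤ −log λ_i"* for `i ≤ j` (TeX L2272). [cite: Dimock2013BalabanIII, §3.5 proof of Lemma 15 (arXiv:1304.0705v1 TeX L2272)] -/
theorem ell_anti {L : ℕ} (hL : 1 ≤ L) {lam : ℝ} {N : ℕ} {i j : Fin (N + 2)} (hij : i ≤ j) :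
    ell L lam N j ≤ ell L lam N i := by
  have hlog : 0 ≤ Real.log L := Real.log_nonneg (by exact_mod_cast hL)
  have hdep : (dep N j : ℝ) ≤ dep N i := by
    have : dep N j ≤ dep N i := Nat.sub_le_sub_left (show i.val ≤ j.val from hij) N
    exact_mod_cast this
  unfold ell
  nlinarith

/-- `e^{−ell_j} = λ_j = λ / L^{dep j}`. [folklore] -/
theorem exp_neg_ell {L : ℕ} [NeZero L] {lam : ℝ} (hlam : 0 < lam) (N : ℕ) (j : Fin (N + 2)) :
    exp (-ell L lam N j) = lam / (L : ℝ) ^ dep N j := by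
  have hL : (0 : ℝ) < L := by exact_mod_cast Nat.pos_of_ne_zero (NeZero.ne L)
  unfold ell
  rw [neg_sub, Real.exp_sub, Real.exp_log hlam, Real.exp_nat_mul, Real.exp_log hL]

/-- `Σ_{j=0}^{𝖭+1} 2^{−dep j} ≤ 3` (depths `𝖭, 𝖭−1, …, 1, 0, 0`). [folklore] -/
theorem sum_half_pow_dep_le (N : ℕ) : ∑ j : Fin (N + 2), (1 / 2 : ℝ) ^ dep N j ≤ 3 := by
  have h1 : ∑ j : Fin (N + 2), (1 / 2 : ℝ) ^ dep N j = ∑ i ∈ range (N + 2), (1 / 2 : ℝ) ^ (N - i) :=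
    Fin.sum_univ_eq_sum_range (fun i => (1 / 2 : ℝ) ^ (N - i)) (N + 2)
  rw [h1, Finset.sum_range_succ, Nat.sub_eq_zero_of_le (Nat.le_succ N), pow_zero]
  have h2 : ∑ i ∈ range (N + 1), (1 / 2 : ℝ) ^ (N - i) = ∑ i ∈ range (N + 1), (1 / 2 : ℝ) ^ i := by
    rw [← Finset.sum_range_reflect (fun i => (1 / 2 : ℝ) ^ i) (N + 1)]
    refine sum_congr rfl fun i hi => ?_
    simp only [add_tsub_cancel_right]
  rw [h2]
  linarith [sum_geometric_two_le (N + 1)]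

/-- **(sally) ⇒ "≤ |Θ|_M" — THE HISTORY SUM PROVED ON THE TORUS.**  [Dimock2013BalabanIII] TeX L2310–2334, verbatim:
*"Now drop all conditions on P_j, Q_j, R_j except that they are unions of L^{−(𝖭−j)}M cubes □ contained in Θ. Each sum is
estimated separately. For P_j we use |𝒞_j| ≥ |P_j|_{L^{𝖭−j}M} and estimate Σ_{P_j ⊂ Θ} exp(−(1/9) c₂ p²_{0,j}
|P_j|_{L^{(N−j)}M}) = Π_{□⊂Θ} (1 + e^{−(1/9)c₂p²_{0,j}}) ≤ Π_{□⊂Θ} (1 + λ_j^{n₀}) ≤ Π_{□⊂Θ} e^{λ_j^{n₀}} ≤ exp(λ_j^{n₀}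
|Θ|_{L^{(N−j)}M}). The estimates on Q_j, R_j are the same. (R_{N+1} has M-cubes, not LM cubes, but this only improves
things.) Our bound becomes |𝒦′(Θ)| ≤ λ^{n₀} e^{−κ|Θ|_M} exp(Σ_{j=0}^{𝖭+1} 3λ_j^{n₀}|Θ|_{L^{(𝖭−j)}M}). But |Θ|_{L^{(𝖭−j)}M} =
L^{3(𝖭−j)}|Θ|_M and λ_j^{n₀} = L^{−(N−j)n₀}λ^{n₀}. Since n₀ ≥ 4 the sum in the exponential is bounded by 3λ^{n₀}|Θ|_M
Σ_{j=0}^{𝖭+1} L^{−(N−j)(n₀−3)} ≤ |Θ|_M."*  PROVED at `d = 3` for rates `a_j ≥ n₀ · ell_j` (i.e. `e^{−a_j} ≤ λ_j^{n₀}`),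
`L ≥ 2`, `n₀ ≥ 4`, with the explicit smallness `9 λ^{n₀} ≤ 1` in place of the printed tacit one (reading (ii): all
`3(𝖭+2)` slots are free here, the two extra depth-0 slots cost the constant 9 instead of the print's geometric series).
[cite: Dimock2013BalabanIII, §3.5 proof of Lemma 15, (sally) (arXiv:1304.0705v1 TeX L2310–2334)] -/
theorem sally {N : ℕ} (Θ : Finset (TPt 3 n)) {lam : ℝ} {a : Fin (N + 2) → ℝ} {n₀ : ℕ} (hn₀ : 4 ≤ n₀)
    (hL : 2 ≤ L) (hlam : 0 < lam) (ha : ∀ j, n₀ * ell L lam N j ≤ a j) :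
    ∑ h ∈ freeHist L n N Θ, ∏ j, ∏ X, exp (-(a j * (h j X).card)) ≤ exp (9 * lam ^ n₀ * Θ.card) := by
  refine (sum_freeHist_prod_exp_le Θ a).trans (Real.exp_le_exp.2 ?_)
  have hLr : (2 : ℝ) ≤ L := by exact_mod_cast hL
  have hL1 : (1 : ℝ) ≤ L := by linarith
  -- per level: #fine_j · e^{−a_j} ≤ |Θ| λ^{n₀} 2^{−dep j}
  have key : ∀ j : Fin (N + 2),
      ((fine L n (dep N j) Θ).card : ℝ) * exp (-(a j)) ≤ Θ.card * (lam ^ n₀ * (1 / 2 : ℝ) ^ dep N j) := by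
    intro j
    set P : ℝ := (L : ℝ) ^ dep N j with hP
    have hP1 : 1 ≤ P := one_le_pow₀ hL1
    have hPpos : 0 < P := by linarith
    have hcard : ((fine L n (dep N j) Θ).card : ℝ) ≤ P ^ 3 * Θ.card := by
      have := card_fine_le L n (dep N j) Θ
      have h' : (((L ^ dep N j) ^ 3 * Θ.card : ℕ) : ℝ) = P ^ 3 * Θ.card := by push_cast; rw [hP]
      rw [← h']
      exact_mod_cast this
    have hexp : exp (-(a j)) ≤ (lam / P) ^ n₀ := by
      calc exp (-(a j)) ≤ exp (-(n₀ * ell L lam N j)) := Real.exp_le_exp.2 (by linarith [ha j])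
        _ = (lam / P) ^ n₀ := by
          rw [show -(n₀ * ell L lam N j) = (n₀ : ℝ) * (-ell L lam N j) by ring, Real.exp_nat_mul,
            exp_neg_ell hlam]
    have hq : P ^ 3 * (lam / P) ^ n₀ ≤ lam ^ n₀ * (1 / 2 : ℝ) ^ dep N j := by
      rw [div_pow, show P ^ 3 * (lam ^ n₀ / P ^ n₀) = lam ^ n₀ * (P ^ 3 / P ^ n₀) by ring]
      refine mul_le_mul_of_nonneg_left ?_ (pow_nonneg hlam.le _)
      have h3 : P ^ 3 / P ^ n₀ = 1 / P ^ (n₀ - 3) := by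
        rw [eq_div_iff (pow_ne_zero _ hPpos.ne'), div_mul_eq_mul_div, ← pow_add,
          show 3 + (n₀ - 3) = n₀ by omega, div_self (pow_ne_zero _ hPpos.ne')]
      rw [h3, one_div_pow]
      have h4 : (2 : ℝ) ^ dep N j ≤ P ^ (n₀ - 3) :=
        calc (2 : ℝ) ^ dep N j ≤ P := by rw [hP]; exact pow_le_pow_left₀ (by norm_num) hLr _
          _ = P ^ 1 := (pow_one P).symm
          _ ≤ P ^ (n₀ - 3) := pow_le_pow_right₀ hP1 (by omega)
      exact one_div_le_one_div_of_le (pow_pos (by norm_num) _) h4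
    calc ((fine L n (dep N j) Θ).card : ℝ) * exp (-(a j))
        ≤ (P ^ 3 * Θ.card) * (lam / P) ^ n₀ :=
          mul_le_mul hcard hexp (exp_pos _).le (by positivity)
      _ = Θ.card * (P ^ 3 * (lam / P) ^ n₀) := by ring
      _ ≤ Θ.card * (lam ^ n₀ * (1 / 2 : ℝ) ^ dep N j) :=
          mul_le_mul_of_nonneg_left hq (Nat.cast_nonneg _)
  calc 3 * ∑ j : Fin (N + 2), ((fine L n (dep N j) Θ).card : ℝ) * exp (-(a j))
      ≤ 3 * ∑ j : Fin (N + 2), Θ.card * (lam ^ n₀ * (1 / 2 : ℝ) ^ dep N j) := by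
        exact mul_le_mul_of_nonneg_left (sum_le_sum fun j _ => key j) (by norm_num)
    _ = 3 * lam ^ n₀ * Θ.card * ∑ j : Fin (N + 2), (1 / 2 : ℝ) ^ dep N j := by
        rw [← mul_sum, ← mul_sum]; ring
    _ ≤ 3 * lam ^ n₀ * Θ.card * 3 :=
        mul_le_mul_of_nonneg_left (sum_half_pow_dep_le N) (by positivity)
    _ = 9 * lam ^ n₀ * Θ.card := by ring

end Torus


/-! ## Part 3. LEMMA 15 (sushi) from (randall) ∧ LEMMA 14 (ugh2): the printed arithmetic, kernel-checked -/

section Sushi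

variable {L n N : ℕ} [NeZero L] [NeZero n]

/-- *"M^{−3}(|P_j^{(j)}| + |Q_j^{(j)}| + |R_j^{(j)}|)"* of (randall): the SUM of the three cube counts of level `j`
(`|P^{(j)}_j|` = number of unit cubes = `M³ ×` number of `L^{−(k−j)}M` cubes, TeX L2166–2170).
[cite: Dimock2013BalabanIII, §3.4 eq. (randall) and §3.5 eq. (ugh1) (arXiv:1304.0705v1 TeX L2149–2153, L2166–2170)] -/
def cnt (h : Hist 3 L n N) (j : Fin (N + 2)) : ℕ := (h j 0).card + (h j 1).card + (h j 2).card

/-- `|𝒞_j|` — TeX L2166: *"Let 𝒞_j be the set of all L^{−(k−j)}M cubes in P_j ∪ Q_j ∪ R_j"*: the number of cubes of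
the UNION of the three regions of level `j`. [cite: Dimock2013BalabanIII, §3.5 (arXiv:1304.0705v1 TeX L2164–2170)] -/
def ucnt (h : Hist 3 L n N) (j : Fin (N + 2)) : ℕ := (h j 0 ∪ h j 1 ∪ h j 2).card

/-- `|𝒞_j| ≤ |P_j| + |Q_j| + |R_j|` (the print's (ugh1) writes "=", exact for disjoint regions; "≤" is what is used:
TeX L2275–2276 *"in (randall) replace M^{−3}Σ … by Σ_j |𝒞_j|"* inside a negative exponent). [cite: Dimock2013BalabanIII, §3.5 eq. (ugh1) (arXiv:1304.0705v1 TeX L2166–2170)] -/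
theorem ucnt_le_cnt (h : Hist 3 L n N) (j : Fin (N + 2)) : ucnt h j ≤ cnt h j := by
  unfold ucnt cnt
  have h1 := card_union_le (h j 0 ∪ h j 1) (h j 2)
  have h2 := card_union_le (h j 0) (h j 1)
  omega

/-- `Σ_{X ∈ {P,Q,R}} |X_j| = |P_j| + |Q_j| + |R_j|`. [folklore] -/
theorem sum_card_eq_cnt (h : Hist 3 L n N) (j : Fin (N + 2)) : ∑ X, (h j X).card = cnt h j := by
  rw [Fin.sum_univ_three]; rfl

/-- THE EXPONENT OF (randall) for one history — [Dimock2013BalabanIII] TeX L2149–2153, verbatim: *"|𝒦′(Θ)| ≤ Σ_{{P_j,Q_j,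
R_j}: Λ^c_{𝖭+1} = Θ} exp( Σ_{j=0}^{𝖭+1} C(−log λ_j)|(Λ_j^c)^{(j)}| − c₂ p²_{0,j} M^{−3}(|P^{(j)}_j| + |Q^{(j)}_j| +
|R^{(j)}_j|) )"* — with the VOLUMES `|(Λ_j^c)^{(j)}|` abstracted as a function `v` of the history (the recursion
(understood), TeX L1654–1660, is not modelled) and `p²_{0,j} = ((−log λ_j)^{p₀})² = ell_j^{2p₀}` ([Dimock2013BalabanII]
TeX L3640 *"for p_{0,k} ≤ p_k"*, `p_k = (−log λ_k)^p` D3 TeX L279). [cite: Dimock2013BalabanIII, §3.4 eq. (randall) (arXiv:1304.0705v1 TeX L2149–2155)] -/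
def randallExponent (v : Hist 3 L n N → Fin (N + 2) → ℝ) (C c₂ p₀ lam : ℝ) (h : Hist 3 L n N) : ℝ :=
  ∑ j, (C * ell L lam N j * v h j - c₂ * ell L lam N j ^ (2 * p₀) * (cnt h j : ℝ))

/-- **(randall) as a hypothesis shape** (TeX L2149–2155, quoted at `randallExponent`; *"Here Ω_j, Λ_j are defined from
P_j, Q_j, R_j by (understood) and P₀, R₀, Q_{𝖭+1}, P_{𝖭+1} = ∅. At this point all the fields are gone."*): the number
`KΘ` (print: `|𝒦′(Θ)|`) is at most the sum of `exp(randallExponent)` over a finite set `H` of histories (print: those with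
`Λ^c_{𝖭+1} = Θ`) with volume function `v`.  It is the OUTPUT of §3.2–3.4 (the analytic part: characteristic functions,
small factors, Gaussian integrals) and is NOT asserted here. [cite: Dimock2013BalabanIII, §3.4 eq. (randall) (arXiv:1304.0705v1 TeX L2149–2155)] -/
def RandallBound (KΘ : ℝ) (H : Finset (Hist 3 L n N)) (v : Hist 3 L n N → Fin (N + 2) → ℝ)
    (C c₂ p₀ lam : ℝ) : Prop :=
  KΘ ≤ ∑ h ∈ H, exp (randallExponent v C c₂ p₀ lam h)

/-- **LEMMA 14 (ugh2) as a hypothesis shape, in the two forms used in the proof of Lemma 15** — [Dimock2013BalabanIII]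
TeX L2173–2177, verbatim: *"Vol(Λ_k^c) = |(Λ_k^c)^{(k)}| ≤ 𝒪(1)(M r_k)³ (|𝒞₀| + … + |𝒞_k|)"* (a PUBLISHED, PROVED covering
lemma about Dimock's own regions Λ_k^c, proof TeX L2180–2249 by induction over (understood); `r_k = (−log λ_k)^r` for a
positive integer `r`, [Dimock2013BalabanII] TeX L1653–1655).  Typed for the abstract volumes `v h j` of the (randall)
shape, with `𝒪(1) ↦ A`: (1) at every level `j`, `v h j ≤ A (M · ell_j^r)³ Σ_{i ≤ j} |𝒞_i|` — the form used at TeX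
L2262–2271; (2) at the top, where `Λ^c_{𝖭+1} = Θ` and `|Θ^{(𝖭)}| = M³|Θ|_M`: `|Θ|_M ≤ A · r_𝖭³ · Σ_{j ≤ 𝖭+1} |𝒞_j|` —
the form used at TeX L2287–2294 (*"The second exponential is bounded using (ugh2) again … ≤ exp(−c₂′ p²_{0,𝖭} (M
r_𝖭)^{−3} |(Λ^c_{𝖭+1})^{(𝖭)}|) = exp(−c₂′(−log λ)^{2p₀−3r}|Θ|_M)"*).  NOT re-proved here (the geometric leaf of this
module; reading (i) of the header). [cite: Dimock2013BalabanIII, §3.5 Lemma 14 eq. (ugh2) (arXiv:1304.0705v1 TeX L2173–2177)] -/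
def Ugh2Bound (Θ : Finset (TPt 3 n)) (H : Finset (Hist 3 L n N)) (v : Hist 3 L n N → Fin (N + 2) → ℝ)
    (A M lam : ℝ) (r : ℕ) : Prop :=
  (∀ h ∈ H, ∀ j : Fin (N + 2),
      v h j ≤ A * (M * ell L lam N j ^ r) ^ 3 * ∑ i ∈ univ.filter (fun i => i ≤ j), (ucnt h i : ℝ)) ∧
    ∀ h ∈ H, (Θ.card : ℝ) ≤ A * (ell L lam N (Fin.last (N + 1)) ^ r) ^ 3 * ∑ i, (ucnt h i : ℝ)

/-- **THE PARAMETER CONDITIONS OF LEMMA 15, EXPLICIT.**  Print fixes the signs and orders by convention ([Dimock2013BalabanIII]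
TeX L387: *"𝒪(1) stands for a generic constant independent of all parameters, C stands for a generic constant possibly
depending on L"*; Theorem 1: *"a fixed integer n₀ ≥ 4"* (TeX L334); *"some positive integer r"* (II, TeX L1655)) and
asks for largeness in words; here every use is a named inequality on `ℓ₀ := −log λ`:
* `exps` — TeX L2287: *"We can assume 3r + 2 < 2p₀."* (the non-strict form suffices given `first`);
* `first` — TeX L2287: *"Then for −log λ and hence −log λ_j sufficiently large, the first exponential is bounded by
  one"*, i.e. `C·𝒪(1)·M³ (−log λ_i)^{3r+2} ≤ ⅓ c₂ (−log λ_i)^{2p₀}`; as the inequality `3 C A M³ ≤ c₂ ℓ₀^{2p₀−3r−2}`;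
* `kappa` — TeX L2299: *"assume ½ c₂′ (−log λ)^{2p₀−3r} ≥ κ"* with `c₂′ = c₂/(3A)` (the constant produced at TeX L2292);
* `power` — the companion of `kappa` that the print uses tacitly for the factor `λ^{n₀}` at TeX L2294–2299 (*"≤ λ^{n₀}
  e^{−κ|Θ|_M}. In the last we use |Θ|_M ≥ 1"*): `n₀ ≤ ½ c₂′ (−log λ)^{2p₀−3r−1}`;
* `slot` — TeX L2314–2316: *"Π_{□⊂Θ}(1 + e^{−(1/9)c₂p²_{0,j}}) ≤ Π_{□⊂Θ}(1 + λ_j^{n₀})"*, i.e. `e^{−c p²_{0,j}} ≤ λ_j^{n₀}`;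
  here with `c = c₂/3` (reading (iv)): `3 n₀ ≤ c₂ ℓ₀^{2p₀−1}`;
* `nine` — TeX L2330–2334: *"the sum in the exponential is bounded by … ≤ |Θ|_M"*: `9 λ^{n₀} ≤ 1` (reading (ii));
* `logL`, `ell₀` — TeX L2272: *"N − i ≤ (N−i) log L − log λ = −log λ_i"* (needs `log L ≥ 1`, i.e. `L ≥ 3`: the
  printed sentence is stated without this proviso and fails for `L = 2`, `N − i` large — a Dimock-internal tacit
  assumption, recorded for the cell's T-G22 list (XREAD C-ref6-116 A2); we also use `−log λ ≥ 2` to count the `𝖭+2`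
  levels, reading (iii)).
[cite: Dimock2013BalabanIII, §3.5 proof of Lemma 15 (arXiv:1304.0705v1 TeX L2262–2335)] -/
structure LargeLog (C c₂ p₀ A M κ lam : ℝ) (r n₀ L : ℕ) : Prop where
  /-- the `C` of (randall) (*"a generic constant possibly depending on L"*, TeX L388) is non-negative -/
  C_nonneg : 0 ≤ C
  /-- the `c₂` of Lemma 13 (citizen) / (randall) is non-negative -/
  c₂_nonneg : 0 ≤ c₂
  /-- the `𝒪(1)` of Lemma 14 (ugh2) is positive -/
  A_pos : 0 < A
  /-- `M ≥ 0` (in print `M = L^m`) -/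
  M_nonneg : 0 ≤ M
  /-- the decay rate `κ` is non-negative -/
  κ_nonneg : 0 ≤ κ
  /-- `λ > 0` -/
  lam_pos : 0 < lam
  /-- *"a fixed integer n₀ ≥ 4"* (TeX L334) -/
  n₀_four : 4 ≤ n₀
  /-- `log L ≥ 1` (used at TeX L2272: *"N − i ≤ (N−i) log L − log λ"*) -/
  logL : 1 ≤ Real.log L
  /-- `−log λ ≥ 2` (pays the two extra levels in the same count, reading (iii)) -/
  ell₀ : 2 ≤ -Real.log lam
  /-- *"We can assume 3r + 2 < 2p₀"* (TeX L2287), non-strict form -/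
  exps : (3 * r + 2 : ℝ) ≤ 2 * p₀
  /-- *"the first exponential is bounded by one"* (TeX L2287): `3 C 𝒪(1) M³ ≤ c₂ (−log λ)^{2p₀−3r−2}` -/
  first : 3 * C * A * M ^ 3 ≤ c₂ * (-Real.log lam) ^ (2 * p₀ - (3 * r + 2))
  /-- *"assume ½ c₂′ (−log λ)^{2p₀−3r} ≥ κ"* (TeX L2299), `c₂′ = c₂/(3·𝒪(1))` -/
  kappa : κ ≤ c₂ / (6 * A) * (-Real.log lam) ^ (2 * p₀ - 3 * r)
  /-- the tacit companion giving the factor `λ^{n₀}` (TeX L2294–2299): `n₀ ≤ ½ c₂′ (−log λ)^{2p₀−3r−1}` -/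
  power : (n₀ : ℝ) ≤ c₂ / (6 * A) * (-Real.log lam) ^ (2 * p₀ - 3 * r - 1)
  /-- *"(1 + e^{−(1/9)c₂p²_{0,j}}) ≤ (1 + λ_j^{n₀})"* (TeX L2315–2316), with ⅓ (reading (iv)): `3n₀ ≤ c₂(−log λ)^{2p₀−1}` -/
  slot : 3 * (n₀ : ℝ) ≤ c₂ * (-Real.log lam) ^ (2 * p₀ - 1)
  /-- *"the sum in the exponential is bounded by … ≤ |Θ|_M"* (TeX L2330–2334), explicit (reading (ii)): `9λ^{n₀} ≤ 1` -/
  nine : 9 * lam ^ n₀ ≤ 1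

namespace LargeLog

variable {C c₂ p₀ A M κ lam : ℝ} {r n₀ L : ℕ}

/-- `L ≥ 3` (from `log L ≥ 1`). [folklore] -/
theorem three_le_L (hp : LargeLog C c₂ p₀ A M κ lam r n₀ L) : 3 ≤ L := by
  by_contra hlt
  have hL : L ≤ 2 := by omega
  have h1 : Real.log L ≤ Real.log 2 := by
    rcases Nat.eq_zero_or_pos L with h0 | hpos
    · rw [h0, Nat.cast_zero, Real.log_zero]; exact Real.log_nonneg (by norm_num)
    · exact Real.log_le_log (by exact_mod_cast hpos) (by exact_mod_cast hL)
  linarith [hp.logL, Real.log_two_lt_d9]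

/-- `L ≥ 1`. [folklore] -/
theorem one_le_L (hp : LargeLog C c₂ p₀ A M κ lam r n₀ L) : 1 ≤ L := le_trans (by norm_num) hp.three_le_L

/-- `λ < 1`, indeed `λ ≤ 1`. [folklore] -/
theorem lam_le_one (hp : LargeLog C c₂ p₀ A M κ lam r n₀ L) : lam ≤ 1 := by
  by_contra h
  have : 0 < Real.log lam := Real.log_pos (by linarith)
  linarith [hp.ell₀]

/-- every `ell_j ≥ ℓ₀ ≥ 2 > 0`. [folklore] -/
theorem ell_pos (hp : LargeLog C c₂ p₀ A M κ lam r n₀ L) (N : ℕ) (j : Fin (N + 2)) : 0 < ell L lam N j := by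
  linarith [neg_log_le_ell hp.one_le_L (lam := lam) N j, hp.ell₀]

end LargeLog

/-- rpow bookkeeping: `x^{a−k} · x^k = x^a` (`x > 0`, `k ∈ ℕ`). [folklore] -/
theorem rpow_sub_mul_pow {x : ℝ} (hx : 0 < x) (a : ℝ) (k : ℕ) : x ^ (a - k) * x ^ k = x ^ a := by
  rw [← Real.rpow_natCast x k, ← Real.rpow_add hx, sub_add_cancel]

/-- rpow bookkeeping: `x^{a−k−1} · x · x^k = x^a` (`x > 0`, `k ∈ ℕ`). [folklore] -/
theorem rpow_sub_sub_one_mul {x : ℝ} (hx : 0 < x) (a : ℝ) (k : ℕ) : x ^ (a - k - 1) * x * x ^ k = x ^ a := by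
  rw [← Real.rpow_add_one hx.ne', sub_add_cancel, rpow_sub_mul_pow hx]

/-- STEP (S2) — TeX L2287 *"the first exponential is bounded by one"*, termwise: for `x = −log λ_i ≥ −log λ`,
`C A M³ x^{3r+2} ≤ ⅓ c₂ x^{2p₀}`. [cite: Dimock2013BalabanIII, §3.5 proof of Lemma 15 (arXiv:1304.0705v1 TeX L2275–2287)] -/
theorem first_term_le {C c₂ p₀ A M κ lam : ℝ} {r n₀ L : ℕ} (hp : LargeLog C c₂ p₀ A M κ lam r n₀ L) {x : ℝ}
    (hx : -Real.log lam ≤ x) : C * A * M ^ 3 * x ^ (3 * r + 2) ≤ c₂ / 3 * x ^ (2 * p₀) := by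
  have hℓ₀ : 0 < -Real.log lam := by linarith [hp.ell₀]
  have hxpos : 0 < x := by linarith
  have hsplit : x ^ (2 * p₀) = x ^ (2 * p₀ - (3 * r + 2 : ℕ)) * x ^ (3 * r + 2) :=
    (rpow_sub_mul_pow hxpos (2 * p₀) (3 * r + 2)).symm
  have hmono : (-Real.log lam) ^ (2 * p₀ - (3 * r + 2)) ≤ x ^ (2 * p₀ - (3 * r + 2 : ℕ)) := by
    rw [show ((3 * r + 2 : ℕ) : ℝ) = 3 * r + 2 by push_cast; ring]
    exact Real.rpow_le_rpow hℓ₀.le hx (by linarith [hp.exps])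
  have hxk : 0 ≤ x ^ (3 * r + 2) := pow_nonneg hxpos.le _
  calc C * A * M ^ 3 * x ^ (3 * r + 2) = 1 / 3 * (3 * C * A * M ^ 3) * x ^ (3 * r + 2) := by ring
    _ ≤ 1 / 3 * (c₂ * (-Real.log lam) ^ (2 * p₀ - (3 * r + 2))) * x ^ (3 * r + 2) :=
        mul_le_mul_of_nonneg_right (mul_le_mul_of_nonneg_left hp.first (by norm_num)) hxk
    _ ≤ 1 / 3 * (c₂ * x ^ (2 * p₀ - (3 * r + 2 : ℕ))) * x ^ (3 * r + 2) :=
        mul_le_mul_of_nonneg_right (mul_le_mul_of_nonneg_left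
          (mul_le_mul_of_nonneg_left hmono hp.c₂_nonneg) (by norm_num)) hxk
    _ = c₂ / 3 * x ^ (2 * p₀) := by rw [hsplit]; ring

/-- STEP (S4), the slot rate — TeX L2314–2316 *"(1 + e^{−(1/9)c₂p²_{0,j}}) ≤ (1 + λ_j^{n₀})"*: `n₀ · ell_j ≤ ⅓ c₂ ell_j^{2p₀}`,
i.e. `e^{−⅓c₂p²_{0,j}} ≤ λ_j^{n₀}`. [cite: Dimock2013BalabanIII, §3.5 proof of Lemma 15 (arXiv:1304.0705v1 TeX L2311–2316)] -/
theorem slot_rate_le {C c₂ p₀ A M κ lam : ℝ} {r n₀ L : ℕ} (hp : LargeLog C c₂ p₀ A M κ lam r n₀ L) (N : ℕ)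
    (j : Fin (N + 2)) : n₀ * ell L lam N j ≤ c₂ / 3 * ell L lam N j ^ (2 * p₀) := by
  set x := ell L lam N j with hxdef
  have hℓ₀ : 0 < -Real.log lam := by linarith [hp.ell₀]
  have hx : -Real.log lam ≤ x := neg_log_le_ell hp.one_le_L N j
  have hxpos : 0 < x := by linarith
  have hsplit : x ^ (2 * p₀) = x ^ (2 * p₀ - 1) * x := by
    rw [← Real.rpow_add_one hxpos.ne', sub_add_cancel]
  have hmono : (-Real.log lam) ^ (2 * p₀ - 1) ≤ x ^ (2 * p₀ - 1) :=
    Real.rpow_le_rpow hℓ₀.le hx (by have := hp.exps; have : (0:ℝ) ≤ r := Nat.cast_nonneg r; linarith)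
  calc (n₀ : ℝ) * x = 1 / 3 * (3 * n₀) * x := by ring
    _ ≤ 1 / 3 * (c₂ * (-Real.log lam) ^ (2 * p₀ - 1)) * x :=
        mul_le_mul_of_nonneg_right (mul_le_mul_of_nonneg_left hp.slot (by norm_num)) hxpos.le
    _ ≤ 1 / 3 * (c₂ * x ^ (2 * p₀ - 1)) * x :=
        mul_le_mul_of_nonneg_right (mul_le_mul_of_nonneg_left
          (mul_le_mul_of_nonneg_left hmono hp.c₂_nonneg) (by norm_num)) hxpos.le
    _ = c₂ / 3 * x ^ (2 * p₀) := by rw [hsplit]; ring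

/-- The number of levels `≥ i` is at most `−log λ_i` — TeX L2272: *"and N − i ≤ (N−i) log L − log λ = −log λ_i"* (with the
two extra levels paid by `−log λ ≥ 2`). [cite: Dimock2013BalabanIII, §3.5 proof of Lemma 15 (arXiv:1304.0705v1 TeX L2263–2272)] -/
theorem card_levels_ge_le_ell {C c₂ p₀ A M κ lam : ℝ} {r n₀ L : ℕ} (hp : LargeLog C c₂ p₀ A M κ lam r n₀ L) (N : ℕ)
    (i : Fin (N + 2)) : ((univ.filter fun j : Fin (N + 2) => i ≤ j).card : ℝ) ≤ ell L lam N i := by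
  have hset : (univ.filter fun j : Fin (N + 2) => i ≤ j) = Finset.Ici i := by ext j; simp
  rw [hset, Fin.card_Ici]
  have h1 : (N + 2 - (i : ℕ) : ℕ) ≤ dep N i + 2 := by unfold dep; omega
  have h2 : ((N + 2 - (i : ℕ) : ℕ) : ℝ) ≤ (dep N i : ℝ) + 2 := by exact_mod_cast h1
  have h3 : (dep N i : ℝ) ≤ (dep N i : ℝ) * Real.log L := by
    have := hp.logL; have h0 : (0 : ℝ) ≤ dep N i := Nat.cast_nonneg _
    nlinarith
  unfold ell
  linarith [hp.ell₀]

/-- STEP (S1) — TeX L2262–2272, verbatim: *"Σ_{j=0}^{𝖭+1} (−log λ_j)|(Λ^c_j)^{(j)}| ≤ 𝒪(1) Σ_{j=0}^{𝖭+1} (−log λ_j)(M r_j)³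
Σ_{i=0}^{j} |𝒞_i| = 𝒪(1) Σ_{i=0}^{𝖭+1} M³|𝒞_i| Σ_{j=i}^{𝖭+1} (−log λ_j) r_j³ ≤ 𝒪(1) Σ_{i=0}^{𝖭+1} M³ (−log λ_i)^{3r+2}
|𝒞_i|. In the last step we use r_j³ = (−log λ_j)^{3r} and −log λ_j ≤ −log λ_i and N − i ≤ (N−i) log L − log λ = −log
λ_i."* [cite: Dimock2013BalabanIII, §3.5 proof of Lemma 15 (arXiv:1304.0705v1 TeX L2262–2272)] -/
theorem sum_vol_le {C c₂ p₀ A M κ lam : ℝ} {r n₀ : ℕ} (hp : LargeLog C c₂ p₀ A M κ lam r n₀ L)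
    {Θ : Finset (TPt 3 n)} {H : Finset (Hist 3 L n N)} {v : Hist 3 L n N → Fin (N + 2) → ℝ}
    (hU : Ugh2Bound Θ H v A M lam r) {h : Hist 3 L n N} (hh : h ∈ H) :
    ∑ j, C * ell L lam N j * v h j
      ≤ C * A * M ^ 3 * ∑ i, ell L lam N i ^ (3 * r + 2) * (ucnt h i : ℝ) := by
  have hellpos := hp.ell_pos N
  -- (a) insert (ugh2) termwise
  have ha : ∀ j : Fin (N + 2), C * ell L lam N j * v h j ≤
      C * A * M ^ 3 * ∑ i ∈ univ.filter (fun i => i ≤ j), ell L lam N j ^ (3 * r + 1) * (ucnt h i : ℝ) := by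
    intro j
    calc C * ell L lam N j * v h j
        ≤ C * ell L lam N j * (A * (M * ell L lam N j ^ r) ^ 3 *
            ∑ i ∈ univ.filter (fun i => i ≤ j), (ucnt h i : ℝ)) :=
          mul_le_mul_of_nonneg_left (hU.1 h hh j) (mul_nonneg hp.C_nonneg (hellpos j).le)
      _ = C * A * M ^ 3 * ∑ i ∈ univ.filter (fun i => i ≤ j), ell L lam N j ^ (3 * r + 1) * (ucnt h i : ℝ) := by
          simp only [Finset.mul_sum]
          exact sum_congr rfl fun i _ => by ring
  -- (b) −log λ_j ≤ −log λ_i inside the triangle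
  have hb : ∀ j : Fin (N + 2),
      ∑ i ∈ univ.filter (fun i => i ≤ j), ell L lam N j ^ (3 * r + 1) * (ucnt h i : ℝ)
        ≤ ∑ i ∈ univ.filter (fun i => i ≤ j), ell L lam N i ^ (3 * r + 1) * (ucnt h i : ℝ) := by
    intro j
    refine sum_le_sum fun i hi => ?_
    have hij : i ≤ j := (mem_filter.1 hi).2
    exact mul_le_mul_of_nonneg_right
      (pow_le_pow_left₀ (hellpos j).le (ell_anti hp.one_le_L hij) _) (Nat.cast_nonneg _)
  -- (c) exchange the order of summation
  have hc : ∑ j, ∑ i ∈ univ.filter (fun i => i ≤ j), ell L lam N i ^ (3 * r + 1) * (ucnt h i : ℝ)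
      = ∑ i, ((univ.filter fun j : Fin (N + 2) => i ≤ j).card : ℝ) *
          (ell L lam N i ^ (3 * r + 1) * (ucnt h i : ℝ)) := by
    have hf : ∀ j : Fin (N + 2), ∑ i ∈ univ.filter (fun i => i ≤ j), ell L lam N i ^ (3 * r + 1) * (ucnt h i : ℝ)
        = ∑ i, if i ≤ j then ell L lam N i ^ (3 * r + 1) * (ucnt h i : ℝ) else 0 :=
      fun j => sum_filter _ _
    simp_rw [hf]
    rw [sum_comm]
    refine sum_congr rfl fun i _ => ?_
    rw [← sum_filter, sum_const, nsmul_eq_mul]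
  -- (d) the number of levels above `i` is at most −log λ_i
  have hd : ∀ i : Fin (N + 2), ((univ.filter fun j : Fin (N + 2) => i ≤ j).card : ℝ) *
      (ell L lam N i ^ (3 * r + 1) * (ucnt h i : ℝ)) ≤ ell L lam N i ^ (3 * r + 2) * (ucnt h i : ℝ) := by
    intro i
    have hnn : 0 ≤ ell L lam N i ^ (3 * r + 1) * (ucnt h i : ℝ) :=
      mul_nonneg (pow_nonneg (hellpos i).le _) (Nat.cast_nonneg _)
    calc _ ≤ ell L lam N i * (ell L lam N i ^ (3 * r + 1) * (ucnt h i : ℝ)) :=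
          mul_le_mul_of_nonneg_right (card_levels_ge_le_ell hp N i) hnn
      _ = ell L lam N i ^ (3 * r + 2) * (ucnt h i : ℝ) := by ring
  have hCAM : 0 ≤ C * A * M ^ 3 := by
    have := hp.C_nonneg; have := hp.A_pos; have := hp.M_nonneg; positivity
  calc ∑ j, C * ell L lam N j * v h j
      ≤ ∑ j, C * A * M ^ 3 * ∑ i ∈ univ.filter (fun i => i ≤ j), ell L lam N i ^ (3 * r + 1) * (ucnt h i : ℝ) :=
        sum_le_sum fun j _ => (ha j).trans (mul_le_mul_of_nonneg_left (hb j) hCAM)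
    _ = C * A * M ^ 3 * ∑ i, ((univ.filter fun j : Fin (N + 2) => i ≤ j).card : ℝ) *
          (ell L lam N i ^ (3 * r + 1) * (ucnt h i : ℝ)) := by rw [← mul_sum, hc]
    _ ≤ C * A * M ^ 3 * ∑ i, ell L lam N i ^ (3 * r + 2) * (ucnt h i : ℝ) :=
        mul_le_mul_of_nonneg_left (sum_le_sum fun i _ => hd i) hCAM

/-- STEP (S3) — TeX L2287–2299, verbatim: *"The second exponential is bounded using (ugh2) again. With a new constant c₂′
it is less than exp(Σ_{j=0}^{𝖭+1} −⅓c₂p²_{0,j}|𝒞_j|) ≤ exp(−⅓c₂p²_{0,𝖭} Σ_{j=0}^{𝖭+1}|𝒞_j|) ≤ exp(−c₂′p²_{0,𝖭}(Mr_𝖭)^{−3}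
|(Λ^c_{𝖭+1})^{(𝖭)}|) = exp(−c₂′(−log λ)^{2p₀−3r}|Θ|_M) ≤ λ^{n₀}e^{−κ|Θ|_M}. In the last we use |Θ|_M ≥ 1 and assume
½c₂′(−log λ)^{2p₀−3r} ≥ κ."* — in the per-cube form `(κ + n₀(−log λ))|Θ|_M ≤ ⅓c₂ Σ_j p²_{0,j}|𝒞_j|` (fields `kappa`,
`power`; `c₂′ = c₂/(3A)`). [cite: Dimock2013BalabanIII, §3.5 proof of Lemma 15 (arXiv:1304.0705v1 TeX L2287–2299)] -/
theorem mass_le_third {C c₂ p₀ A M κ lam : ℝ} {r n₀ : ℕ} (hp : LargeLog C c₂ p₀ A M κ lam r n₀ L)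
    {Θ : Finset (TPt 3 n)} {H : Finset (Hist 3 L n N)} {v : Hist 3 L n N → Fin (N + 2) → ℝ}
    (hU : Ugh2Bound Θ H v A M lam r) {h : Hist 3 L n N} (hh : h ∈ H) :
    (κ + n₀ * (-Real.log lam)) * Θ.card ≤ c₂ / 3 * ∑ j, ell L lam N j ^ (2 * p₀) * (ucnt h j : ℝ) := by
  set ℓ₀ := -Real.log lam with hℓ₀def
  have hℓ₀ : 0 < ℓ₀ := by have := hp.ell₀; linarith
  have hA := hp.A_pos
  have hlast : ell L lam N (Fin.last (N + 1)) = ℓ₀ := by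
    simp [ell, dep, hℓ₀def]
  set U : ℝ := ∑ i, (ucnt h i : ℝ) with hUdef
  have hU0 : 0 ≤ U := sum_nonneg fun i _ => Nat.cast_nonneg _
  -- the top form of (ugh2): |Θ| ≤ A ℓ₀^{3r} U
  have htop : (Θ.card : ℝ) ≤ A * ℓ₀ ^ (3 * r) * U := by
    have := hU.2 h hh
    rw [hlast, ← pow_mul, mul_comm r 3] at this
    exact this
  -- (κ + n₀ ℓ₀) A ℓ₀^{3r} ≤ ⅓ c₂ ℓ₀^{2p₀}
  have hk : κ * (A * ℓ₀ ^ (3 * r)) ≤ c₂ / 6 * ℓ₀ ^ (2 * p₀) := by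
    calc κ * (A * ℓ₀ ^ (3 * r)) ≤ (c₂ / (6 * A) * ℓ₀ ^ (2 * p₀ - 3 * r)) * (A * ℓ₀ ^ (3 * r)) :=
          mul_le_mul_of_nonneg_right hp.kappa (by positivity)
      _ = c₂ / 6 * (ℓ₀ ^ (2 * p₀ - (3 * r : ℕ)) * ℓ₀ ^ (3 * r)) := by
          rw [show ((3 * r : ℕ) : ℝ) = 3 * r by push_cast; ring]
          field_simp
      _ = c₂ / 6 * ℓ₀ ^ (2 * p₀) := by rw [rpow_sub_mul_pow hℓ₀]
  have hn : n₀ * ℓ₀ * (A * ℓ₀ ^ (3 * r)) ≤ c₂ / 6 * ℓ₀ ^ (2 * p₀) := by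
    calc n₀ * ℓ₀ * (A * ℓ₀ ^ (3 * r))
        ≤ (c₂ / (6 * A) * ℓ₀ ^ (2 * p₀ - 3 * r - 1)) * ℓ₀ * (A * ℓ₀ ^ (3 * r)) := by
          gcongr; exact hp.power
      _ = c₂ / 6 * (ℓ₀ ^ (2 * p₀ - (3 * r : ℕ) - 1) * ℓ₀ * ℓ₀ ^ (3 * r)) := by
          rw [show ((3 * r : ℕ) : ℝ) = 3 * r by push_cast; ring]
          field_simp
      _ = c₂ / 6 * ℓ₀ ^ (2 * p₀) := by rw [rpow_sub_sub_one_mul hℓ₀]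
  -- ℓ₀^{2p₀} U ≤ Σ_j ell_j^{2p₀} |𝒞_j|
  have hmono : ℓ₀ ^ (2 * p₀) * U ≤ ∑ j, ell L lam N j ^ (2 * p₀) * (ucnt h j : ℝ) := by
    rw [hUdef, mul_sum]
    refine sum_le_sum fun j _ => mul_le_mul_of_nonneg_right ?_ (Nat.cast_nonneg _)
    exact Real.rpow_le_rpow hℓ₀.le (neg_log_le_ell hp.one_le_L N j)
      (by have := hp.exps; have : (0:ℝ) ≤ r := Nat.cast_nonneg r; linarith)
  have hκn : 0 ≤ κ + n₀ * ℓ₀ := by have := hp.κ_nonneg; positivity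
  calc (κ + n₀ * ℓ₀) * Θ.card ≤ (κ + n₀ * ℓ₀) * (A * ℓ₀ ^ (3 * r) * U) :=
        mul_le_mul_of_nonneg_left htop hκn
    _ = (κ * (A * ℓ₀ ^ (3 * r)) + n₀ * ℓ₀ * (A * ℓ₀ ^ (3 * r))) * U := by ring
    _ ≤ (c₂ / 6 * ℓ₀ ^ (2 * p₀) + c₂ / 6 * ℓ₀ ^ (2 * p₀)) * U :=
        mul_le_mul_of_nonneg_right (add_le_add hk hn) hU0
    _ = c₂ / 3 * (ℓ₀ ^ (2 * p₀) * U) := by ring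
    _ ≤ c₂ / 3 * ∑ j, ell L lam N j ^ (2 * p₀) * (ucnt h j : ℝ) :=
        mul_le_mul_of_nonneg_left hmono (by have := hp.c₂_nonneg; positivity)

/-- THE EXPONENT BOUND per history: (S1)+(S2)+(S3) give `randallExponent ≤ −(κ + n₀(−log λ))|Θ|_M − ⅓c₂ Σ_j p²_{0,j}
(|P_j|+|Q_j|+|R_j|)` — TeX L2275–2286: *"… and then split it into three equal pieces. Then since p_{0,j} = (−log λ_j)^{p₀}
we have |𝒦′(Θ)| ≤ Σ exp(Σ_j (CM³(−log λ_i)^{3r+2} − ⅓c₂(−log λ_j)^{2p₀})|𝒞_j|) exp(Σ_j −⅓c₂p²_{0,j}|𝒞_j|) exp(Σ_j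
−⅓c₂p²_{0,j}|𝒞_j|)"*. [cite: Dimock2013BalabanIII, §3.5 proof of Lemma 15 (arXiv:1304.0705v1 TeX L2275–2299)] -/
theorem randallExponent_le {C c₂ p₀ A M κ lam : ℝ} {r n₀ : ℕ} (hp : LargeLog C c₂ p₀ A M κ lam r n₀ L)
    {Θ : Finset (TPt 3 n)} {H : Finset (Hist 3 L n N)} {v : Hist 3 L n N → Fin (N + 2) → ℝ}
    (hU : Ugh2Bound Θ H v A M lam r) {h : Hist 3 L n N} (hh : h ∈ H) :
    randallExponent v C c₂ p₀ lam h ≤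
      -((κ + n₀ * (-Real.log lam)) * Θ.card) - c₂ / 3 * ∑ j, ell L lam N j ^ (2 * p₀) * (cnt h j : ℝ) := by
  have hellpos := hp.ell_pos N
  set T : ℝ := ∑ j, ell L lam N j ^ (2 * p₀) * (cnt h j : ℝ) with hT
  set Tu : ℝ := ∑ j, ell L lam N j ^ (2 * p₀) * (ucnt h j : ℝ) with hTu
  have hE : randallExponent v C c₂ p₀ lam h = (∑ j, C * ell L lam N j * v h j) - c₂ * T := by
    unfold randallExponent
    rw [sum_sub_distrib, hT, mul_sum]
    refine congrArg₂ _ rfl (sum_congr rfl fun j _ => by ring)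
  have hTuT : Tu ≤ T := by
    rw [hT, hTu]
    refine sum_le_sum fun j _ => mul_le_mul_of_nonneg_left ?_ (Real.rpow_nonneg (hellpos j).le _)
    exact_mod_cast ucnt_le_cnt h j
  have hS1 := sum_vol_le hp hU hh
  have hS2 : C * A * M ^ 3 * ∑ i, ell L lam N i ^ (3 * r + 2) * (ucnt h i : ℝ) ≤ c₂ / 3 * Tu := by
    rw [hTu, mul_sum, mul_sum]
    refine sum_le_sum fun i _ => ?_
    have := first_term_le hp (neg_log_le_ell hp.one_le_L N i)
    calc C * A * M ^ 3 * (ell L lam N i ^ (3 * r + 2) * (ucnt h i : ℝ))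
        = (C * A * M ^ 3 * ell L lam N i ^ (3 * r + 2)) * (ucnt h i : ℝ) := by ring
      _ ≤ (c₂ / 3 * ell L lam N i ^ (2 * p₀)) * (ucnt h i : ℝ) :=
          mul_le_mul_of_nonneg_right this (Nat.cast_nonneg _)
      _ = c₂ / 3 * (ell L lam N i ^ (2 * p₀) * (ucnt h i : ℝ)) := by ring
  have hS3 := mass_le_third hp hU hh
  have hc₂ := hp.c₂_nonneg
  have h2 : c₂ * Tu ≤ c₂ * T := mul_le_mul_of_nonneg_left hTuT hc₂
  rw [hE]
  rw [← hTu] at hS3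
  linarith

/-- **LEMMA 15 (sushi), PER-CUBE PRODUCT FORM, from (randall) ∧ LEMMA 14** — [Dimock2013BalabanIII] Lemma 15, verbatim
(TeX L2254–2258): *"𝒦′(Θ) ≤ λ^{n₀} e^{−κ′|Θ|_M}"*, with the Remark (TeX L2338–2342): *"The sum in (randall) factors over
the connected components {Θ_γ} of Θ. The bound (sushi) holds separately for each factor. Using also |Θ_γ|_M ≥ d_M(Θ_γ)
we have 𝒦′(Θ) ≤ Π_γ λ^{n₀} e^{−κ′|Θ_γ|_M}"*.  PROVED here, for every finite set `H` of free histories over `Θ` and every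
volume function `v` satisfying the shapes (randall) and (ugh2), under the explicit parameter conditions `LargeLog`:
`KΘ ≤ (λ^{n₀} e^{−(κ−1)})^{|Θ|_M}` — which implies the printed `λ^{n₀}e^{−(κ−1)|Θ|_M}` for `|Θ|_M ≥ 1` and the product
form over any partition of `Θ` (`prod_form_of_perCube`), at rate `κ − 1` (*"Since κ − 1 > κ′ this yields the desired
bound"*, TeX L2335).  The printed proof is followed step by step: (S1) `sum_vol_le`, (S2) `first_term_le`, (S3)
`mass_le_third`, (S4) the history sum `sally`; the per-cube power `λ^{n₀|Θ|_M}` (instead of one `λ^{n₀}` per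
component) is what (S3) gives once the tacit largeness is written as the field `power`.
[cite: Dimock2013BalabanIII, §3.5 Lemma 15 eq. (sushi) (arXiv:1304.0705v1 TeX L2254–2342)] -/
theorem sushi_of_randall {C c₂ p₀ A M κ lam : ℝ} {r n₀ : ℕ} (hp : LargeLog C c₂ p₀ A M κ lam r n₀ L)
    {Θ : Finset (TPt 3 n)} {KΘ : ℝ} {H : Finset (Hist 3 L n N)} {v : Hist 3 L n N → Fin (N + 2) → ℝ}
    (hH : H ⊆ freeHist L n N Θ) (hR : RandallBound KΘ H v C c₂ p₀ lam) (hU : Ugh2Bound Θ H v A M lam r) :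
    KΘ ≤ (lam ^ n₀ * exp (-(κ - 1))) ^ Θ.card := by
  have hlam := hp.lam_pos
  set ℓ₀ := -Real.log lam with hℓ₀def
  set a : Fin (N + 2) → ℝ := fun j => c₂ / 3 * ell L lam N j ^ (2 * p₀) with hadef
  -- the reduced weight of a history, as a product over the slots
  have hprod : ∀ h : Hist 3 L n N,
      exp (-(c₂ / 3 * ∑ j, ell L lam N j ^ (2 * p₀) * (cnt h j : ℝ))) = ∏ j, ∏ X, exp (-(a j * (h j X).card)) := by
    intro h
    rw [mul_sum, ← sum_neg_distrib, Real.exp_sum]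
    refine prod_congr rfl fun j _ => ?_
    rw [← Real.exp_sum, sum_neg_distrib, ← mul_sum, ← Nat.cast_sum, sum_card_eq_cnt]
    congr 1
    rw [hadef]
    ring
  -- Step 1: the exponent bound, history by history
  have h1 : KΘ ≤ ∑ h ∈ H, exp (-((κ + n₀ * ℓ₀) * Θ.card)) * ∏ j, ∏ X, exp (-(a j * (h j X).card)) := by
    refine hR.trans (sum_le_sum fun h hh => ?_)
    rw [← hprod, ← Real.exp_add]
    exact Real.exp_le_exp.2 (by linarith [randallExponent_le hp hU hh])
  -- Step 2: enlarge to the free histories and use (sally)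
  have h2 : ∑ h ∈ H, ∏ j, ∏ X, exp (-(a j * (h j X).card))
      ≤ ∑ h ∈ freeHist L n N Θ, ∏ j, ∏ X, exp (-(a j * (h j X).card)) :=
    sum_le_sum_of_subset_of_nonneg hH fun h _ _ =>
      prod_nonneg fun j _ => prod_nonneg fun X _ => (exp_pos _).le
  have h3 : ∑ h ∈ freeHist L n N Θ, ∏ j, ∏ X, exp (-(a j * (h j X).card)) ≤ exp (9 * lam ^ n₀ * Θ.card) :=
    sally Θ hp.n₀_four (le_trans (by norm_num) hp.three_le_L) hlam fun j => slot_rate_le hp N j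
  have h4 : exp (9 * lam ^ n₀ * Θ.card) ≤ exp (Θ.card) := by
    refine Real.exp_le_exp.2 ?_
    have := hp.nine
    have h0 : (0 : ℝ) ≤ Θ.card := Nat.cast_nonneg _
    nlinarith
  -- Step 3: assemble
  have h5 : exp (-((κ + n₀ * ℓ₀) * Θ.card)) * exp (Θ.card) = (lam ^ n₀ * exp (-(κ - 1))) ^ Θ.card := by
    rw [← Real.exp_add, show -((κ + n₀ * ℓ₀) * Θ.card) + Θ.card = (Θ.card : ℝ) * (n₀ * Real.log lam + -(κ - 1)) by
      rw [hℓ₀def]; ring, Real.exp_nat_mul, Real.exp_add, Real.exp_nat_mul, Real.exp_log hlam]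
  calc KΘ ≤ ∑ h ∈ H, exp (-((κ + n₀ * ℓ₀) * Θ.card)) * ∏ j, ∏ X, exp (-(a j * (h j X).card)) := h1
    _ = exp (-((κ + n₀ * ℓ₀) * Θ.card)) * ∑ h ∈ H, ∏ j, ∏ X, exp (-(a j * (h j X).card)) := by
        rw [mul_sum]
    _ ≤ exp (-((κ + n₀ * ℓ₀) * Θ.card)) * exp (Θ.card) :=
        mul_le_mul_of_nonneg_left ((h2.trans h3).trans h4) (exp_pos _).le
    _ = (lam ^ n₀ * exp (-(κ - 1))) ^ Θ.card := h5

/-- FROM THE PER-CUBE FORM TO THE PRINTED FORMS.  (a) `|Θ|_M ≥ 1 ⇒ KΘ ≤ λ^{n₀} e^{−(κ−1)|Θ|_M}` (Lemma 15 as printed, at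
rate `κ − 1 ≥ κ′`). [cite: Dimock2013BalabanIII, §3.5 Lemma 15 eq. (sushi) (arXiv:1304.0705v1 TeX L2254–2258)] -/
theorem printed_of_perCube {KΘ lam κ₁ : ℝ} {n₀ t : ℕ} (hlam : 0 < lam) (hlam1 : lam ≤ 1) (ht : 1 ≤ t)
    (h : KΘ ≤ (lam ^ n₀ * exp (-κ₁)) ^ t) : KΘ ≤ lam ^ n₀ * exp (-(κ₁ * t)) := by
  refine h.trans ?_
  rw [mul_pow, ← Real.exp_nat_mul, show (t : ℝ) * -κ₁ = -(κ₁ * t) by ring]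
  refine mul_le_mul_of_nonneg_right ?_ (exp_pos _).le
  rw [← pow_mul]
  exact pow_le_pow_of_le_one hlam.le hlam1 (by nlinarith)

/-- (b) THE COMPONENT (PRODUCT) FORM of the Remark TeX L2338–2342: for any finite family `𝒯` of pairwise disjoint
non-empty parts with union `Θ`, `KΘ ≤ Π_{T∈𝒯} λ^{n₀} e^{−κ₁|T|_M}`. [cite: Dimock2013BalabanIII, §3.5 Remark after Lemma 15 (arXiv:1304.0705v1 TeX L2338–2342)] -/
theorem prod_form_of_perCube {m : ℕ} {KΘ lam κ₁ : ℝ} {n₀ : ℕ} (hlam : 0 < lam) (hlam1 : lam ≤ 1)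
    {𝒯 : Finset (Finset (TPt 3 m))} (hne : ∀ T ∈ 𝒯, T.Nonempty)
    (hdisj : (𝒯 : Set (Finset (TPt 3 m))).PairwiseDisjoint id)
    (h : KΘ ≤ (lam ^ n₀ * exp (-κ₁)) ^ (𝒯.biUnion id).card) :
    KΘ ≤ ∏ T ∈ 𝒯, lam ^ n₀ * exp (-(κ₁ * T.card)) := by
  rw [card_biUnion hdisj, ← prod_pow_eq_pow_sum] at h
  refine h.trans (prod_le_prod (fun T _ => by positivity) fun T hT => ?_)
  have h1 : 1 ≤ (id T).card := card_pos.2 (hne T hT)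
  exact printed_of_perCube hlam hlam1 h1 le_rfl

end Sushi

/-! ## Part 4. (under) as a hypothesis shape; the substitution (under) ∧ (sushi) ⇒ (under2) -/

section Under

variable {n : ℕ} [NeZero n]

/-- LEMMA 15 IN PER-CUBE FORM as a hypothesis shape for an abstract `𝒦′`: `𝒦′(Θ) ≤ (λ^{n₀} e^{−κ₁})^{|Θ|_M}` for every
union `Θ` of `M`-cubes — the conclusion of `sushi_of_randall` (with `κ₁ = κ − 1`), which implies the printed (sushi)
`λ^{n₀}e^{−κ₁|Θ|_M}` (`printed_of_perCube`) and its component form (`prod_form_of_perCube`). [cite: Dimock2013BalabanIII, §3.5 Lemma 15 eq. (sushi) and Remark (arXiv:1304.0705v1 TeX L2254–2258, L2338–2342)] -/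
def SushiPerCube (K' : Finset (TPt 3 n) → ℝ) (lam κ₁ : ℝ) (n₀ : ℕ) : Prop :=
  ∀ Θ : Finset (TPt 3 n), K' Θ ≤ (lam ^ n₀ * exp (-κ₁)) ^ Θ.card

/-- THE SUMMAND OF (under) for the triple (𝒯 = {Θ_γ}, 𝒳 = {X_α}, 𝒴 = {Y_σ}) — [Dimock2013BalabanIII] TeX L1584–1587,
verbatim: *"𝒦(U) ≤ Σ_{{Θ_γ},{Y_σ},{X_α} → U} 𝒦′(Θ) Π_α 𝒪(1) λ^β e^{−κ′ d_M(X_α)} Π_σ λ^β 𝒪(1) B₀ e^{−κ′ d_M(Y_σ, mod Θ)}"*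
with `Θ := ⋃𝒯`, BOTH displayed constants `𝒪(1)` and `𝒪(1)B₀` majorised by one `C` (reading (v): in (under2) the print
itself writes `𝒪(1)` for both, TeX L2355–2356), `d_M := torusTreeLen`, `d_M(·, mod Θ) := torusTreeLenMod · Θ`.
[cite: Dimock2013BalabanIII, §3.2 eq. (under) (arXiv:1304.0705v1 TeX L1583–1601)] -/
def underWeight (K' : Finset (TPt 3 n) → ℝ) (C lam β κ' : ℝ) (𝒯 𝒳 𝒴 : Finset (Finset (TPt 3 n))) : ℝ :=
  K' (𝒯.biUnion id) * (∏ X ∈ 𝒳, C * lam ^ β * exp (-(κ' * torusTreeLen X))) *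
    ∏ Y ∈ 𝒴, C * lam ^ β * exp (-(κ' * torusTreeLenMod Y (𝒯.biUnion id)))

open Classical in
/-- **(under) as a hypothesis shape** — [Dimock2013BalabanIII] §3.2 "first bounds", verbatim (TeX L1583–1601): *"Now with
κ′ = κ − 7κ₀ − 7:  𝒦(U) ≤ Σ_{{Θ_γ},{Y_σ},{X_α} → U} 𝒦′(Θ) Π_α 𝒪(1) λ^β e^{−κ′ d_M(X_α)} Π_σ λ^β 𝒪(1) B₀ e^{−κ′ d_M(Y_σ,
mod Θ)}  where 𝒦′(Θ) = Σ_{Π⁺: Λ^c_{𝖭+1} = Θ} ∫ dΦ̃_{𝖭,Ω^c} dW_{𝖭+1,Π⁺} 𝒞̃_{𝖭+1,Π⁺} Π_{j=0}^{𝖭} exp(c_j|(Ω^c_j)^{(j−1)}| −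
S^{+,u}_{j,L^{−(𝖭−j)}}(Λ_{j−1} − Λ_j) + B₀|Λ^{(j)}_{j−1} − Λ^{(j)}_j|) exp(c̃_{𝖭+1}|(Ω^c_{𝖭+1})^{(𝖭)}| + B₀|Λ^{(𝖭)}_𝖭 −
Λ^{(𝖭)}_{𝖭+1}|)"*, the index set being that of TeX L1469–1471: *"over disjoint Θ_γ, over distinct {X_α} satisfying X_α
⊂ Θ^c and over distinct {Y_σ} satisfying Y_σ # Θ and Y_σ ∈ 𝒟_𝖭(mod Θ)"* with *"→ U"* (TeX L1508–1512) = union `U`,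
overlap-connected.  TYPED with the relaxed index set of this lineage's `ThreeSorted.Under2Bound` (𝒳 any polymers in `U`,
𝒴 ⊆ `modPolymersIn U Θ`, union = `U` only) EXCEPT that 𝒯 is kept PAIRWISE DISJOINT as printed (*"over disjoint Θ_γ"*) —
each relaxation enlarges a sum of non-negative terms (𝒦′ ≥ 0 in print: a sum of integrals of non-negative functions), so
the printed (under) implies this shape.  NOT asserted: it is the output of §3.1–3.2. [cite: Dimock2013BalabanIII, §3.2 eq. (under) (arXiv:1304.0705v1 TeX L1583–1601)] -/
def UnderBound (n : ℕ) [NeZero n] (K : TDom 3 n → ℝ) (K' : Finset (TPt 3 n) → ℝ) (C lam β κ' : ℝ) : Prop :=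
  ∀ U : TDom 3 n,
    |K U| ≤ ∑ 𝒯 ∈ (polymersIn U.1).powerset, ∑ 𝒳 ∈ (polymersIn U.1).powerset,
      ∑ 𝒴 ∈ (modPolymersIn U.1 (𝒯.biUnion id)).powerset,
        if (𝒯 : Set (Finset (TPt 3 n))).PairwiseDisjoint id ∧
            𝒯.biUnion id ∪ 𝒳.biUnion id ∪ 𝒴.biUnion id = U.1
        then underWeight K' C lam β κ' 𝒯 𝒳 𝒴 else 0

/-- THE `Θ`-FACTOR OF THE SUBSTITUTION: from the per-cube (sushi) to *"Π_γ λ^{n₀} e^{−κ′ d_M(Θ_γ)}"* of (under2), using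
*"|Θ_γ|_M ≥ d_M(Θ_γ)"* (TeX L2339; on the cell's model: pv22's `torusTreeLen_le_card_sub_one`) and `κ′ ≤ κ₁`.
[cite: Dimock2013BalabanIII, §3.5 Remark after Lemma 15 and §3.6 eq. (under2) (arXiv:1304.0705v1 TeX L2338–2358)] -/
theorem theta_factor_le {lam κ₁ κ' : ℝ} {n₀ : ℕ} (hlam : 0 < lam) (hlam1 : lam ≤ 1) (hκ' : 0 ≤ κ')
    (hκ : κ' ≤ κ₁) {𝒯 : Finset (Finset (TPt 3 n))} (h𝒯 : ∀ T ∈ 𝒯, T.Nonempty ∧ TFaceConnected T)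
    (hdisj : (𝒯 : Set (Finset (TPt 3 n))).PairwiseDisjoint id) {KΘ : ℝ}
    (h : KΘ ≤ (lam ^ n₀ * exp (-κ₁)) ^ (𝒯.biUnion id).card) :
    KΘ ≤ ∏ T ∈ 𝒯, lam ^ n₀ * exp (-(κ' * torusTreeLen T)) := by
  refine (prod_form_of_perCube hlam hlam1 (fun T hT => (h𝒯 T hT).1) hdisj h).trans ?_
  refine prod_le_prod (fun T _ => by positivity) fun T hT => ?_
  refine mul_le_mul_of_nonneg_left (Real.exp_le_exp.2 ?_) (pow_nonneg hlam.le _)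
  have h1 := torusTreeLen_le_card_sub_one (h𝒯 T hT).1 (h𝒯 T hT).2
  have h2 : (0 : ℝ) ≤ T.card := Nat.cast_nonneg _
  have h3 := torusTreeLen_nonneg T
  nlinarith

/-- **(under) ∧ (sushi) ⇒ (under2)** — [Dimock2013BalabanIII] TeX L2349–2351, verbatim: *"We return to the estimate on
𝒦(U) where U ∈ 𝒟_𝖭 is a connected union of M cubes in 𝕋^{−𝖭}_𝖬. Substitute the bound on 𝒦′(Θ) into the bound (under) on
𝒦(U) and find"* (under2).  PROVED: the typed (under) shape together with Lemma 15 in per-cube form (any rate `κ₁ ≥ κ′ ≥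
0`) gives this lineage's typed (under2) shape `ThreeSorted.Under2Bound` with the same constants — the disjoint `𝒯` of
(under) being a sub-range of the relaxed `𝒯` of `Under2Bound`, all other terms non-negative.
[cite: Dimock2013BalabanIII, §3.6 eq. (under2) (arXiv:1304.0705v1 TeX L2346–2358)] -/
theorem under2_of_under {K : TDom 3 n → ℝ} {K' : Finset (TPt 3 n) → ℝ} {C lam β κ' κ₁ : ℝ} {n₀ : ℕ}
    (hU : UnderBound n K K' C lam β κ') (hS : SushiPerCube K' lam κ₁ n₀) (hC : 0 ≤ C) (hlam : 0 < lam)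
    (hlam1 : lam ≤ 1) (hκ' : 0 ≤ κ') (hκ : κ' ≤ κ₁) : Under2Bound n K C lam β κ' n₀ := by
  classical
  intro U
  have hUU := hU U
  refine hUU.trans (sum_le_sum fun 𝒯 h𝒯 => sum_le_sum fun 𝒳 _ => sum_le_sum fun 𝒴 _ => ?_)
  have hw : 0 ≤ under2Weight C lam β κ' n₀ 𝒯 𝒳 𝒴 := by
    unfold under2Weight
    refine mul_nonneg (mul_nonneg ?_ ?_) ?_
    · exact prod_nonneg fun T _ => by positivity
    · exact prod_nonneg fun X _ => by positivity
    · exact prod_nonneg fun Y _ => by positivity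
  by_cases hcov : 𝒯.biUnion id ∪ 𝒳.biUnion id ∪ 𝒴.biUnion id = U.1
  · rw [if_pos hcov]
    by_cases hdisj : (𝒯 : Set (Finset (TPt 3 n))).PairwiseDisjoint id
    · rw [if_pos ⟨hdisj, hcov⟩]
      unfold underWeight under2Weight
      have hpoly : ∀ T ∈ 𝒯, T.Nonempty ∧ TFaceConnected T := fun T hT =>
        (mem_polymersIn.1 (mem_powerset.1 h𝒯 hT)).1
      have hK' := theta_factor_le hlam hlam1 hκ' hκ hpoly hdisj (hS _)
      refine mul_le_mul_of_nonneg_right (mul_le_mul_of_nonneg_right hK' ?_) ?_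
      · exact prod_nonneg fun X _ => by positivity
      · exact prod_nonneg fun Y _ => by positivity
    · rw [if_neg (fun h => hdisj h.1)]; exact hw
  · rw [if_neg hcov, if_neg (fun h => hcov h.2)]

/-- (randall) ∧ LEMMA 14 for every `Θ` (with its own histories and volumes) ⇒ LEMMA 15 in per-cube form at rate `κ − 1`.
The hypothesis `hRU` is asked for EVERY finite `Θ` — including `Θ = ∅` (where it amounts to `K′ ∅ ≤ 1`, what the empty
𝒯-product of (under2) needs) and non-connected `Θ` — whereas the print quantifies over the actual `Θ = Λ^c_{𝖭+1}`:
a stronger hypothesis, hence a weaker theorem, consistent with the relaxed index sets of reading (vii) (XREAD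
C-ref6-116 A1). [cite: Dimock2013BalabanIII, §3.5 Lemma 15 (arXiv:1304.0705v1 TeX L2254–2335)] -/
theorem sushiPerCube_of_randall {L N : ℕ} [NeZero L] {K' : Finset (TPt 3 n) → ℝ}
    {C c₂ p₀ A M κ lam : ℝ} {r n₀ : ℕ} (hp : LargeLog C c₂ p₀ A M κ lam r n₀ L)
    (hRU : ∀ Θ : Finset (TPt 3 n), ∃ H : Finset (Hist 3 L n N), ∃ v : Hist 3 L n N → Fin (N + 2) → ℝ,
      H ⊆ freeHist L n N Θ ∧ RandallBound (K' Θ) H v C c₂ p₀ lam ∧ Ugh2Bound Θ H v A M lam r) :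
    SushiPerCube K' lam (κ - 1) n₀ := fun Θ => by
  obtain ⟨H, v, hH, hR, hUg⟩ := hRU Θ
  exact sushi_of_randall hp hH hR hUg

end Under

/-! ## Part 5. The end chain of [Dimock2013BalabanIII] §3 from (stingray) ∧ (under) ∧ (randall) ∧ Lemma 14 on -/

section EndChain

open Literature.MathematicalPhysics.QuantumFieldTheory.Dimock2011to13.HoleSummability

/-- **(stingray) ∧ (under) ∧ (sushi, per-cube) ⇒ COROLLARY 1** over the cell's polymer model: this module's
`under2_of_under` composed with `HoleSummability.stability_of_under2` ((under2) ⇒ [Lemma 16] (under3) ⇒ (toot) ⇒ Lemma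
17 (swat) ⇒ [with (stingray), Kotecký–Preiss] Theorem 2 ⇒ Corollary 1, with (summing0), (snow) discharged).  The rate of
(under)/(under2) is `κ′`, the per-cube (sushi) rate any `κ₁ ≥ κ′` (print: `κ − 1 > κ′ = κ − 7κ₀ − 7`, TeX L1583, L2335).
[cite: Dimock2013BalabanIII, §3.2–3.6 (arXiv:1304.0705v1 TeX L1583–1601, L2254–2505)] -/
theorem stability_of_under {L m Mv N : ℕ} [NeZero L] [NeZero (L ^ (Mv - m))] {lam ε₀ μ₀ : ℝ}
    {K : TDom 3 (L ^ (Mv - m)) → ℝ} {K' : Finset (TPt 3 (L ^ (Mv - m))) → ℝ}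
    {C β κ' κ₀ κ₁ r₁ : ℝ} {n₀ : ℕ} (hm : m ≤ Mv)
    (hrep : ComponentRepresentation L Mv N (L ^ (Mv - m)) lam ε₀ μ₀ K)
    (hund : UnderBound (L ^ (Mv - m)) K K' C lam β κ') (hsushi : SushiPerCube K' lam κ₁ n₀)
    (hκ₁ : κ' ≤ κ₁) (hκ₀ : kappa₀ 32 6 ≤ κ₀) (hκ₁' : kappa₁ 3 ≤ κ₀) (hκ : κ₀ ≤ κ') (hC : 0 ≤ C)
    (hlam : 0 < lam) (hlam1 : lam ≤ 1) (hβn₀ : β ≤ n₀)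
    (hsmall : lam ^ (β / 2) * Real.exp (2 * (κ' - κ₀)) ≤ 1)
    (htoot : 32 * (K₀ 32 6 + C * K₀ 32 6 + C * K₁ 3) * lam ^ (β / 2) ≤ 1)
    (hr₁ : kappa₀ 32 6 ≤ r₁) (hrate : r₁ + 2 * kappa₀ 32 6 + 2 ≤ κ' - κ₀ - 1)
    (hKP : Real.exp (1 / 4) * lam ^ (β / 2) * Real.exp (5 * r₁ + 1) * K₀ 32 6 * 32 ≤ 1)
    (hM : Real.exp 1 * 32 * K₀ 32 6 ^ 2 * Real.exp (1 / 4) * K₀ 32 6 ≤ ((L : ℝ) ^ m) ^ 3) :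
    Real.exp (-(lam ^ (β / 2) * (L : ℝ) ^ (3 * Mv))) ≤ relativePartitionFunction L Mv N 1 lam ε₀ μ₀ ∧
      relativePartitionFunction L Mv N 1 lam ε₀ μ₀ ≤ Real.exp (lam ^ (β / 2) * (L : ℝ) ^ (3 * Mv)) := by
  have hκ' : 0 ≤ κ' := ((B12TreeDecay.kappa₀_nonneg (by norm_num) 6).trans hκ₀).trans hκ
  exact HoleSummability.stability_of_under2 hm hrep (under2_of_under hund hsushi hC hlam hlam1 hκ' hκ₁) hκ₀ hκ₁'
    hκ hC hlam hlam1 hβn₀ hsmall htoot hr₁ hrate hKP hM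

/-- **(stingray) ∧ (under) ∧ (randall) ∧ LEMMA 14 ⇒ COROLLARY 1** — everything of [Dimock2013BalabanIII] §3 after *"At
this point all the fields are gone"* (TeX L2155) is thereby KERNEL-CHECKED over the cell's torus polymer model, with
Lemma 14 (ugh2) (the covering lemma for Dimock's regions Λ_k^c) as the one quoted geometric leaf and (stingray), (under),
(randall) — the outputs of the analytic §§3.1–3.4 — as the hypothesis shapes.  `Cr` is the `C` of (randall) (an
L-dependent constant in print), `C` the `𝒪(1)` of (under); the per-cube (sushi) rate is `κ − 1`, so `κ′ ≤ κ − 1` is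
required (print: `κ′ = κ − 7κ₀ − 7`). [cite: Dimock2013BalabanIII, §3 (arXiv:1304.0705v1 TeX L1418–2505)] -/
theorem stability_of_randall {L m Mv N : ℕ} [NeZero L] [NeZero (L ^ (Mv - m))] {lam ε₀ μ₀ : ℝ}
    {K : TDom 3 (L ^ (Mv - m)) → ℝ} {K' : Finset (TPt 3 (L ^ (Mv - m))) → ℝ}
    {C Cr c₂ p₀ A M κ β κ' κ₀ r₁ : ℝ} {r n₀ : ℕ} (hm : m ≤ Mv)
    (hrep : ComponentRepresentation L Mv N (L ^ (Mv - m)) lam ε₀ μ₀ K)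
    (hund : UnderBound (L ^ (Mv - m)) K K' C lam β κ')
    (hp : LargeLog Cr c₂ p₀ A M κ lam r n₀ L)
    (hRU : ∀ Θ : Finset (TPt 3 (L ^ (Mv - m))), ∃ H : Finset (Hist 3 L (L ^ (Mv - m)) N),
      ∃ v : Hist 3 L (L ^ (Mv - m)) N → Fin (N + 2) → ℝ,
        H ⊆ freeHist L (L ^ (Mv - m)) N Θ ∧ RandallBound (K' Θ) H v Cr c₂ p₀ lam ∧ Ugh2Bound Θ H v A M lam r)
    (hκ₁ : κ' ≤ κ - 1) (hκ₀ : kappa₀ 32 6 ≤ κ₀) (hκ₁' : kappa₁ 3 ≤ κ₀) (hκ : κ₀ ≤ κ') (hC : 0 ≤ C)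
    (hβn₀ : β ≤ n₀) (hsmall : lam ^ (β / 2) * Real.exp (2 * (κ' - κ₀)) ≤ 1)
    (htoot : 32 * (K₀ 32 6 + C * K₀ 32 6 + C * K₁ 3) * lam ^ (β / 2) ≤ 1)
    (hr₁ : kappa₀ 32 6 ≤ r₁) (hrate : r₁ + 2 * kappa₀ 32 6 + 2 ≤ κ' - κ₀ - 1)
    (hKP : Real.exp (1 / 4) * lam ^ (β / 2) * Real.exp (5 * r₁ + 1) * K₀ 32 6 * 32 ≤ 1)
    (hM : Real.exp 1 * 32 * K₀ 32 6 ^ 2 * Real.exp (1 / 4) * K₀ 32 6 ≤ ((L : ℝ) ^ m) ^ 3) :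
    Real.exp (-(lam ^ (β / 2) * (L : ℝ) ^ (3 * Mv))) ≤ relativePartitionFunction L Mv N 1 lam ε₀ μ₀ ∧
      relativePartitionFunction L Mv N 1 lam ε₀ μ₀ ≤ Real.exp (lam ^ (β / 2) * (L : ℝ) ^ (3 * Mv)) :=
  stability_of_under hm hrep hund (sushiPerCube_of_randall hp hRU) hκ₁ hκ₀ hκ₁' hκ hC hp.lam_pos hp.lam_le_one
    hβn₀ hsmall htoot hr₁ hrate hKP hM

end EndChain

end Literature.MathematicalPhysics.QuantumFieldTheory.Dimock2011to13.HistorySum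

end
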